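import Literature.MathematicalPhysics.QuantumFieldTheory.Balaban1983to89.B4Lower18

/-!
# `Balaban1983to89.B4Cor23Zero` — B4's Corollary 2.3, the `L²` decay estimate (2.30) for the four pairings
`⟨f, G_k(Ω,A)f'⟩`, `⟨f, D^η_{A,μ}G_k(Ω,A)f'⟩`, `⟨f, G_k(Ω,A)D^{η*}_{A,ν}f'⟩`, `⟨f, D^η_{A,μ}G_k(Ω,A)D^{η*}_{A,ν}f'⟩`, in the
case `A = 0`, for EVERY mesh `η = 1/n`, EVERY finite union `Ω` of unit blocks (hence every union of big blocks), EVERY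
mass `m² ≥ 0` and `a > 0`, and EVERY pair `f, f'`, with the EXPLICIT constants `c₀(a) = 4(1 + 4/min(2,a))(1 + 1/min(2,a))`
and `δ₀(d,a) = min(2,a)/(4(d+1+a))` (`cor23_main_zeroField`, `cor23_main_zeroField_fineDom`).  HYPOTHESIS-FREE (a
sibling of `B4Lower18`, whose region operator `fineOpR` — the operator of (1.6) on a union of blocks —, its coercivity
`lower18` and its massless, derivative-free set-to-set decay `green_setDecay_region` are USED; of `Beta.CombesThomasForm` /
`Beta.CombesThomasFormOp` / `Beta.BlockPoincare`, whose conjugation-error and Dirichlet-form lemmas are USED; no existing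
module is touched; nothing of B4 at `A ≠ 0` and nothing about `δG_k(Ω,Ω₀,A)` is asserted).

Source under audit (cell pub-balaban): T. Bałaban, *Regularity and decay of lattice Green's functions*, Commun. Math.
Phys. **89** (1983) 571–597 [`Balaban1983RegularityDecay`, "B4"], p. 572 [PDF 2] (1.1), (1.3)–(1.6), p. 573 [PDF 3]
Theorem (Proposition 2.1 of [1]), p. 580 [PDF 10] (2.29), Remark and Corollary 2.3 (2.30), p. 581 [PDF 11] (end of the
Corollary) (journal page = PDF page + 570; renders
`b2b-balaban-ref1/pages/1983-cmp89-regularity-decay/1983-cmp89-regularity-decay-p00N-x2.png`, read as images; cell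
transcript `b2b-balaban-b04/transcript-B4.md`).  Method: J. M. Combes, L. Thomas, Commun. Math. Phys. **34** (1973)
251–270 [`CombesThomas1973`], §II (exponentially conjugated resolvent), in the quadratic-form version of the lineage's
`Beta.CombesThomasForm(Op)`.

## WHAT IS PRINTED (verbatim; `≦` of the print written `≤`)

p. 572 [PDF 2]: *"We consider subsets Ω which are unions of big blocks."*; *"⟨φ, (−Δ^{η,N}_{A,Ω})φ⟩ = Σ_{b⊂Ω} η^d
|(D^η_Aφ)(b)|² = Σ_{b⊂Ω} η^d |η^{−1}(U(A_b)φ(b₊) − φ(b₋))|², φ : Ω → R^N"* (1.3), where the *"summation is over the set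
of all bonds b = ⟨b₋,b₊⟩ with end-points b₋, b₊ in Ω"*; *"(Q_k(A)φ)(y) = Σ_{x∈B^k(y)} η^d U(A(Γ^{(k)}_{y,x})) φ(x),
y ∈ Z^d"* (1.4); *"P_k(A) = Q_k^*(A) Q_k(A)"* (1.5); *"G_k(Ω, A) = (−Δ^{η,N}_{A,Ω} + m² + aP_k(A))^{−1}"* (1.6), *"where
m² ≥ 0 and a is a positive constant close to 1."*

p. 580 [PDF 10], end of the proof of Lemma 2.1: *"‖∂^η_μG_k^{1/2}(□,0)f‖₂² = ⟨f, G_k^{1/2}(□,0)∂^{η*}_μ∂^η_μG_k^{1/2}(□,0)f⟩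
≤ ⟨f, G_k^{1/2}(□,0)(−Δ^{η,N}_□ + m_k² + a_kP_k)G_k^{1/2}(□,0)f⟩ = ‖f‖₂²"* (2.29), *"hence ‖∂^η_μG_k^{1/2}(□,0)‖_{2,2} =
‖G_k^{1/2}(□,0)∂^{η*}_μ‖_{2,2} ≤ 1"*.  Then: *"Remark. Let us notice that this lemma alone implies a weaker version of
Proposition I.2.1 with L²-norms. More exactly we have"*
**Corollary 2.3.** *"If Ω and A are as in Proposition I.2.1, then there exist positive constants c₀, δ₀ such that for
arbitrary scalar field configurations f, f' defined on Ω, we have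
|⟨f, G_k(Ω,A)f'⟩|, |⟨f, D^η_{A,μ}G_k(Ω,A)f'⟩|, |⟨f, G_k(Ω,A)D^{η*}_{A,ν}f'⟩|, |⟨f, D^η_{A,μ}G_k(Ω,A)D^{η*}_{A,ν}f'⟩|
≤ c₀e^{−δ₀dist(supp f, supp f')}‖f‖₂‖f'‖₂."* (2.30)
p. 581 [PDF 11]: *"The same inequalities hold for δG_k(Ω,Ω₀,A) with the additional factor
e^{−δ₀(dist(supp f,Ω^c) + dist(supp f',Ω^c))}."*  *"Of course it is enough to prove it for f, f' with supports in unit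
cubes, and the proof proceeds as before using only the L²-bounds of Lemma 2.1. Let us notice also that now there are no
restrictions on supports of f, f', so in this aspect the Corollary is a little bit stronger than Proposition I.2.1."*
(Proposition I.2.1 = the Theorem of p. 573, whose `Ω` is a union of big blocks and whose `A` is regular, small `e`.)

## WHAT THIS FILE CERTIFIES (kernel-checked, no hypotheses; the lineage is USED, not re-proved)

Throughout `A = 0` (so `U ≡ 1`), spatial dimension `d + 1 =: D` (the paper's `d`), mesh `η = 1/n` with ANY `n ≥ 1`,
everything in LATTICE UNITS and COUNTING BASES as in `B4Lower18`: the region ↔ a finite `R : Finset (Fin (d+1) → ℤ)` of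
fine points which is a union of `n`-blocks (`B4Lower18.IsBlockUnion n R`; e.g. `R = fineDom n Ω`, the union of the blocks
`B^k(y)`, `y ∈ Ω`, for ANY finite set `Ω` of unit labels, `fineDom_isBlockUnion`); the operator of (1.6) at `A = 0` on
it ↔ the matrix `H = B4Lower18.fineOpR n a m² R` (`= n²·(−Δ^N_R) + m²·1 + (a/n^D)·1_{same block}`, form
`B4Lower18.fineOpR_form`), `G_k(Ω,0)` ↔ `H⁻¹`; `D^η_{0,μ}` ↔ `fdiff n R μ` (§B: `(D_μψ)(x) = n(ψ(x+e_μ) − ψ(x))` on the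
bonds `⟨x, x+e_μ⟩ ⊂ R`, `0` where the bond leaves `R` — Neumann), `D^{η*}_{0,ν}` ↔ `fdiffT n R ν` (the transpose
matrix); `dist` ↔ `B4Lower18.edistR n R` (`η`-scaled sup-distance `η‖x − x'‖_∞`); `‖f‖₂` ↔ `l2n f = (Σ_x f(x)²)^{1/2}`.

* (§A, `conjPairing_eq`, `energy_le_two_conjPairing`, `le_four_mul_of_sq_le`) the abstract COMBES–THOMAS ENERGY
  LEMMA for a real matrix `H` with `σ‖ω‖² ≤ ⟨ω,Hω⟩` and conjugation error `≥ −(σ/2)‖w‖²`: for `Hv = g` and `w = e^{φ}v`,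
  `⟨w,Hw⟩ ≤ 2Σ_j w_j e^{φ_j} g_j`.
* (§B, `sum_fdiff_sq_le_form`) the DIRICHLET-FORM BOUND `Σ_x (D_μω)(x)² ≤ ⟨ω, Hω⟩` for every direction `μ`, every mesh,
  `a, m² ≥ 0` — the matrix form of the printed (2.29) *"‖∂^η_μG_k^{1/2}(□,0)‖_{2,2} = ‖G_k^{1/2}(□,0)∂^{η*}_μ‖_{2,2} ≤ 1"*
  on a general union of blocks; `dot_fdiffT` (`⟨u, D_ν^⊤f'⟩ = ⟨D_νu, f'⟩`); `sum_sq_shift_le`.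
* (§C, `hpos_region`, `herr_region`) the two hypotheses of §A for `H`: coercivity `min(2,a)‖ω‖² ≤ ⟨ω,Hω⟩`
  (`B4Lower18.lower18` — the mass only helps) and, for the weight `φ = δ·dist_η(·,T)` with `0 ≤ δ ≤ 1` and the `η`-FREE
  smallness `2(d+1)δ² + a(e^δ − 1) ≤ min(2,a)/2`, the conjugation-error bound (`Beta.CombesThomasFormOp.
  conjError_lap_add_blocks_ge`; the diagonal mass term has zero conjugation error); the weighted LEIBNIZ RULE
  `|D_ν(e^{φ}w)(x)| ≤ e^{φ(x)}(|D_νw(x)| + 2δ|w(x+e_ν)|)` (`abs_fdiff_weighted_le`, `exp_mul_abs_fdiff_le`: the weight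
  moves by `≤ δη` across a bond, and `n|e^{±δ/n} − 1| ≤ 2δ`).
* (§D) the TWO ENERGY BOUNDS `⟨w,Hw⟩ ≤ (4/min(2,a))‖g‖²` for `v = Gg`, `supp g ⊆ T` (`energyA`) and
  `⟨w,Hw⟩ ≤ 8(1 + 4δ²/min(2,a))‖f'‖²` for `v = GD_ν^⊤f'`, `supp f' ⊆ T` (`energyB` — through the pairing
  `⟨D_ν(e^{φ}w), f'⟩`, never through `‖D^⊤f'‖ ∼ n‖f'‖`), the two EXTRACTION LEMMAS on a set `S` with `dist_η(S,T) ≥ ρ`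
  (`sum_sq_le_energy`: `Σ_S v² ≤ e^{−2δρ}⟨w,Hw⟩/min(2,a)`; `sum_fdiff_sq_le_energy`: `Σ_S (D_μv)² ≤ 2e^{−2δρ}(1 +
  4δ²/min(2,a))⟨w,Hw⟩`), and the FOUR SET-TO-SET DECAY ESTIMATES `green_setDecay`, `dgreen_setDecay`,
  `greenT_setDecay`, `dgreenT_setDecay`: `Σ_{x∈S}(Xf')(x)² ≤ K·e^{−2δρ}·Σf'²` for `X ∈ {G, D_μG, GD_ν^⊤, D_μGD_ν^⊤}`,
  `K ∈ {(2/min(2,a))², (8/min(2,a))(1+4δ²/min(2,a)) (twice), 16(1+4δ²/min(2,a))²}`.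
* (§E, `cor23_pairings_set`) **(2.30) AT `A = 0` IN SET FORM**: for `supp f ⊆ S`, `supp f' ⊆ T`, `dist_η(S,T) ≥ ρ` and
  any admissible `δ`: all four `|⟨f, Xf'⟩| ≤ c₀(a)e^{−δρ}‖f‖₂‖f'‖₂` (`consts_le_c0_sq`, Cauchy–Schwarz
  `abs_dot_le_of_setSq`); `delta0_admissible`: `δ₀(d,a)` is admissible (`e^δ − 1 ≤ δ + δ²`, Mathlib's
  `Real.abs_exp_sub_one_sub_id_le`).
* (§F, `cor23_main_zeroField`, `cor23_main_zeroField_fineDom`) **(2.30) AT `A = 0`, PRINTED QUANTIFIER SHAPE**: ONE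
  pair `c₀(a), δ₀(d,a)` for every mesh, every union of blocks `R` (resp. every finite label set `Ω`), every `m² ≥ 0`,
  every `f, f' : R → ℝ` and all `μ, ν`, with `dist_η(supp f, supp f')` (`suppDist`; `= 0` if a support is empty, when
  both sides vanish anyway); a numerical instance (`d + 1 = 4`, `a = 1`: `c₀ = 40`, `δ₀ = 1/20`) is the closing `example`.

Mechanism (for the referee).  The paper proves the Corollary by re-running the random-walk / multi-commutator expansion
of §2 with the `L²` bounds (2.25) of Lemma 2.1 in place of the `L^∞` ones.  At `A = 0` a ONE-STEP Combes–Thomas argument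
in quadratic-form language gives (2.30) directly and uniformly in `η`: conjugate by `e^{φ}`, `φ = δ·dist_η(·, supp f')`;
the conjugation error of `H` is `≥ −(2(d+1)δ² + a(e^δ−1))‖w‖²` because `φ` moves by `≤ δη` across a fine bond (whose
coupling is `η^{-2}`) and by `≤ δ` inside a block (the averaging part, coupling `a` in total per site), and the mass is
diagonal; coercivity `min(2,a)` (`B4Lower18.lower18`) absorbs it.  The energy `E = ⟨w,Hw⟩` of the conjugated solution then obeys `E ≤ 2P`,
`P² ≤ K·E` (so `E ≤ 4K`) where `P` is the conjugated pairing with the source — for the source `D_ν^⊤f'` one moves `D_ν`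
onto `e^{φ}w` by the weighted Leibniz rule and uses (2.29) in the form `Σ(D_νw)² ≤ E`, which is what makes the bound
`η`-uniform.  Values and `η`-differences of `v = e^{−φ}w` on `supp f` are then `e^{−δρ}`-small in `ℓ²`, and Cauchy–Schwarz
against `f` gives the four pairings with one constant.

## DICTIONARY (folklore; each line is used only through the kernel-checked identities named)

* paper's dimension `d` ↔ our `d + 1 =: D`; `η = L^{-k}` ↔ `1/n`; `B^k(y)` ↔ `blk n x = y`; `Ω` (a union of unit — in
  the paper, big — blocks) ↔ `R` with `IsBlockUnion n R` / `fineDom n Ω` (`B4Lower18`, DICTIONARY).  Big blocks are unions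
  of unit blocks, so the paper's regions are among ours.
* `A = 0`: `U ≡ 1`, `D^η_{0,μ}` = the plain forward `η`-difference on the bonds of `Ω` (1.3), `Q_k(0)` = block average,
  `P_k(0)` = the projection onto block-constants; every operator acts componentwise on `φ : Ω → R^N`, so the real scalar
  statements are each component («scalar field configurations f, f'» is the printed setting of the Corollary anyway).
* inner products: the paper's `⟨f,g⟩ = Σ_x η^D f(x)g(x)` and `‖f‖₂ = ⟨f,f⟩^{1/2}` on `Ω ⊂ ηℤ^D`; ours are the counting
  ones.  The operator of (1.6) has the SAME matrix in both (its form (1.3) + `m²‖φ‖₂² + a‖Q_kφ‖²` carries the common factor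
  `η^D`; `B4Lower18`, DICTIONARY), so `G_k(Ω,0) = H⁻¹` as a matrix, `D^η_{0,μ}` is the same matrix, and `D^{η*}_{0,ν}`
  (the adjoint for the weight `η^D` on sites and on bonds alike) is its transpose `fdiffT`; both sides of (2.30) scale by
  the same `η^D` (`⟨f,Xf'⟩_η = η^D·(f ⬝ᵥ Xf')`, `‖f‖_{2,η}‖f'‖_{2,η} = η^D·l2n f·l2n f'`), so (2.30) in the paper's
  normalisation is literally `cor23_main_zeroField`.
* a function on `μ`-bonds `⟨x, x+ηe_μ⟩ ⊂ Ω` ↔ a function of the site `x`, extended by `0` to the sites whose `μ`-bond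
  leaves `Ω` (so `⟨f, D_μGf'⟩` pairs `f` with a bond function, as printed).
* `dist(supp f, supp f')` ↔ `suppDist n R f f'`, the minimum over `supp f × supp f'` of the `η`-scaled SUP-norm distance
  `edistR` (`B4Lower18` §8); for the Euclidean distance the statement holds with `δ₀/√D` in place of `δ₀`
  (`‖·‖_∞ ≥ ‖·‖₂/√D`), not spelled out.

## HONEST SCOPE

* `A = 0` ONLY: the `A`-half of «Ω and A are as in Proposition I.2.1» (regular, `e` small) is then void; NOTHING is
  claimed at `A ≠ 0`, where the paper's proof needs Lemma 2.1 (2.15)/(2.25)–(2.26) for covariant operators (cell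
  census: the `A ≠ 0` chain is open).
* The `δG_k(Ω,Ω₀,A)` clause of the Corollary (p. 581, the extra factor `e^{−δ₀(dist(supp f,Ω^c) + dist(supp f',Ω^c))}`)
  is NOT in this module, and the typed DAG leaf `B4.Cor23Printed` (which bundles it, over an abstract `EtaSetting`
  family) is therefore NOT discharged here; this file is offered as the kernel certificate of the MAIN CLAUSE (2.30) at
  `A = 0` on concrete carriers, on which a discharge can be built.
* Constants: the print has `c₀, δ₀` depending on `d, M` (through Proposition I.2.1); ours depend on `a` (and `δ₀` on
  `d`): `c₀(a) = 4(1 + 4/min(2,a))(1 + 1/min(2,a))`, `δ₀ = min(2,a)/(4(d+1+a))` — uniform in the mesh, the region, the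
  mass and `f, f'`, as printed («independent of A, k, Ω»); no attempt at sharpness (the mass would improve the rate to
  `∼ max(δ₀, m)`; not pursued).  «a is a positive constant close to 1»: any `a > 0` is allowed here.
* Regions: FINITE unions of `n`-blocks in `ℤ^D` (a `Finset`; the paper's `Ω ⊂ T_η` or `⊂ ηℤ^d` are finite unions of big
  blocks in every use); the torus variant is not typed here (cf. `B4TorusGreen244` for the torus operator).  Sup-norm
  distance as said.  `f, f'` real-valued (each component of an `R^N`-valued one).

Value = kernel certificate of a published inequality in a special case (B4 (2.30), all four pairings, at `A = 0`, every
mesh / union of blocks / mass, explicit constants); NOT summit progress (the YangMills / QuantumFields statements are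
untouched).
-/

namespace Literature.MathematicalPhysics.QuantumFieldTheory.Balaban1983to89.B4Cor23Zero

open Finset Matrix
open Literature.MathematicalPhysics.QuantumFieldTheory.Balaban1983to89.B4ContourShift (supNorm supNorm_nonneg)
open Literature.MathematicalPhysics.QuantumFieldTheory.Balaban1983to89.B4Reflection242
open Literature.MathematicalPhysics.QuantumFieldTheory.Balaban1983to89.B4BoxCov237
open Literature.MathematicalPhysics.QuantumFieldTheory.Balaban1983to89.B4Lower18
open Beta.CombesThomasForm (lap lapDefect_le blockDefect_le)
open Beta.CombesThomasFormOp (distTo distTo_le le_distTo distTo_le_zero_of_mem abs_distTo_sub_le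
  conjError_lap_add_blocks_ge weightedSq_le_of_support setSq_le_of_weightedSq)
open Beta.BlockPoincare (lap_form_ge_dirichlet)

noncomputable section

/-! ## §A  Abstract Combes–Thomas energy lemmas (finite index set, real symmetric-free) -/

section Abstract

variable {ι : Type*} [Fintype ι]

/-- **The conjugated pairing identity.**  For any matrix `H`, weight `φ` and vector `v`, with `w = e^{φ} v`:
`Σ_j w_j e^{φ_j} (Hv)_j = ⟨w, Hw⟩ + Σ_{j,k} (e^{φ_j − φ_k} − 1) H_jk w_j w_k`. [cite: CombesThomas1973, §II] [folklore] -/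
theorem conjPairing_eq (H : Matrix ι ι ℝ) (φ v w : ι → ℝ) (hw : ∀ j, w j = Real.exp (φ j) * v j) :
    ∑ j, w j * (Real.exp (φ j) * (H.mulVec v) j)
      = w ⬝ᵥ H.mulVec w + ∑ j, ∑ k, (Real.exp (φ j - φ k) - 1) * H j k * (w j * w k) := by
  have hEAv : ∀ j, Real.exp (φ j) * (H.mulVec v) j = ∑ k, Real.exp (φ j - φ k) * H j k * w k := by
    intro j
    simp only [mulVec, dotProduct, hw, Finset.mul_sum, Real.exp_sub]
    refine Finset.sum_congr rfl fun k _ => ?_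
    field_simp
  have h0 : ∑ j, w j * (Real.exp (φ j) * (H.mulVec v) j) = ∑ j, w j * ∑ k, Real.exp (φ j - φ k) * H j k * w k :=
    Finset.sum_congr rfl fun j _ => by rw [hEAv j]
  rw [h0]
  simp only [dotProduct, mulVec, Finset.mul_sum, ← Finset.sum_add_distrib]
  exact Finset.sum_congr rfl fun j _ => Finset.sum_congr rfl fun k _ => by ring

/-- **Energy ≤ twice the conjugated pairing.**  Under coercivity `σ‖ω‖² ≤ ⟨ω, Hω⟩` and the conjugation-error bound
`−(σ/2)‖w‖² ≤ Σ_{j,k} (e^{φ_j − φ_k} − 1) H_jk w_j w_k`, the conjugated solution `w = e^{φ} v` of `Hv = g` has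
`⟨w, Hw⟩ ≤ 2 Σ_j w_j e^{φ_j} g_j`. [cite: CombesThomas1973, §II] [folklore] -/
theorem energy_le_two_conjPairing (H : Matrix ι ι ℝ) (σ : ℝ) (φ : ι → ℝ)
    (hpos : ∀ ω : ι → ℝ, σ * (ω ⬝ᵥ ω) ≤ ω ⬝ᵥ H.mulVec ω)
    (herr : ∀ w : ι → ℝ, -(σ / 2) * (w ⬝ᵥ w) ≤ ∑ j, ∑ k, (Real.exp (φ j - φ k) - 1) * H j k * (w j * w k))
    (v w : ι → ℝ) (hw : ∀ j, w j = Real.exp (φ j) * v j) :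
    w ⬝ᵥ H.mulVec w ≤ 2 * ∑ j, w j * (Real.exp (φ j) * (H.mulVec v) j) := by
  rw [conjPairing_eq H φ v w hw]
  have h1 := hpos w
  have h2 := herr w
  linarith

/-- arithmetic: `0 ≤ E ≤ 2P` and `P² ≤ K·E` with `K ≥ 0` force `E ≤ 4K`. [folklore] -/
theorem le_four_mul_of_sq_le {E P K : ℝ} (hE : 0 ≤ E) (hK : 0 ≤ K) (h1 : E ≤ 2 * P) (h2 : P ^ 2 ≤ K * E) :
    E ≤ 4 * K := by
  by_cases hE0 : E = 0
  · rw [hE0]; positivity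
  · have hEpos : 0 < E := lt_of_le_of_ne hE (Ne.symm hE0)
    have h3 : E ^ 2 ≤ (2 * P) ^ 2 := pow_le_pow_left₀ hE h1 2
    have h4 : E * E ≤ (4 * K) * E := by nlinarith
    exact le_of_mul_le_mul_right h4 hEpos

omit [Fintype ι] in
/-- Cauchy–Schwarz in the form used below: `(Σ_{i∈s} f_i g_i)² ≤ (Σ_{i∈s} f_i²)(Σ_{i∈s} g_i²)`. [folklore] -/
theorem sq_sum_mul_le (s : Finset ι) (f g : ι → ℝ) :
    (∑ i ∈ s, f i * g i) ^ 2 ≤ (∑ i ∈ s, f i ^ 2) * ∑ i ∈ s, g i ^ 2 :=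
  Finset.sum_mul_sq_le_sq_mul_sq s f g

end Abstract

/-! ## §B  Lattice calculus on a finite region: the forward `η`-difference along the bonds of the region, its
transpose, and the Dirichlet-form bound -/

variable {d : ℕ}

/-- extension by zero off the region. [folklore] -/
def extR {R : Finset (Fin (d + 1) → ℤ)} (ψ : ↥R → ℝ) (z : Fin (d + 1) → ℤ) : ℝ :=
  if h : z ∈ R then ψ ⟨z, h⟩ else 0

/-- the zero extension agrees with the function on the region. [folklore] -/
theorem extR_of_mem {R : Finset (Fin (d + 1) → ℤ)} (ψ : ↥R → ℝ) {z : Fin (d + 1) → ℤ} (h : z ∈ R) :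
    extR ψ z = ψ ⟨z, h⟩ := dif_pos h

/-- the zero extension vanishes off the region. [folklore] -/
theorem extR_of_not_mem {R : Finset (Fin (d + 1) → ℤ)} (ψ : ↥R → ℝ) {z : Fin (d + 1) → ℤ} (h : z ∉ R) :
    extR ψ z = 0 := dif_neg h

/-- **THE FORWARD `η`-DIFFERENCE ALONG `μ` RESTRICTED TO THE BONDS OF THE REGION** (lattice units, `η = 1/n`):
`(D_μ ψ)(x) = n (ψ(x + e_μ) − ψ(x))` if the bond `⟨x, x + e_μ⟩` lies in `R`, and `0` otherwise — the operator
`D^η_{0,μ}` of B4 (1.3)/(2.30) at `A = 0` (`U ≡ 1`) on the bonds «with end-points b₋, b₊ in Ω», whose sum of squares over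
`μ` and the bonds is the Dirichlet part of the form of (1.6) (`sum_fdiff_sq_le_form`).
[cite: Balaban1983RegularityDecay, p. 572 (1.3), case A = 0, dictionary] [folklore] -/
def fdiff (n : ℕ) (R : Finset (Fin (d + 1) → ℤ)) (μ : Fin (d + 1)) (ψ : ↥R → ℝ) (x : ↥R) : ℝ :=
  if x.1 + uvec μ ∈ R then (n : ℝ) * (extR ψ (x.1 + uvec μ) - ψ x) else 0

/-- the forward difference along a bond of the region. [folklore] -/
theorem fdiff_of_mem {n : ℕ} {R : Finset (Fin (d + 1) → ℤ)} {μ : Fin (d + 1)} (ψ : ↥R → ℝ) {x : ↥R}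
    (h : x.1 + uvec μ ∈ R) : fdiff n R μ ψ x = (n : ℝ) * (ψ ⟨x.1 + uvec μ, h⟩ - ψ x) := by
  rw [fdiff, if_pos h, extR_of_mem ψ h]

/-- no bond, no difference (Neumann boundary condition). [folklore] -/
theorem fdiff_of_not_mem {n : ℕ} {R : Finset (Fin (d + 1) → ℤ)} {μ : Fin (d + 1)} (ψ : ↥R → ℝ) {x : ↥R}
    (h : x.1 + uvec μ ∉ R) : fdiff n R μ ψ x = 0 := by
  rw [fdiff, if_neg h]

/-- the matrix of `fdiff`. [folklore] -/
def fdiffM (n : ℕ) (R : Finset (Fin (d + 1) → ℤ)) (μ : Fin (d + 1)) : Matrix ↥R ↥R ℝ :=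
  Matrix.of fun x y =>
    if x.1 + uvec μ ∈ R then (n : ℝ) * ((if y.1 = x.1 + uvec μ then 1 else 0) - (if y = x then 1 else 0)) else 0

/-- the matrix of `D_μ` acts as `fdiff`. [folklore] -/
theorem fdiffM_mulVec (n : ℕ) (R : Finset (Fin (d + 1) → ℤ)) (μ : Fin (d + 1)) (ψ : ↥R → ℝ) :
    (fdiffM n R μ).mulVec ψ = fdiff n R μ ψ := by
  ext x
  by_cases h : x.1 + uvec μ ∈ R
  · rw [fdiff_of_mem ψ h]
    simp only [fdiffM, mulVec, dotProduct, Matrix.of_apply, if_pos h]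
    have h1 : ∀ y : ↥R, (n : ℝ) * ((if y.1 = x.1 + uvec μ then (1 : ℝ) else 0) - (if y = x then 1 else 0)) * ψ y
        = (n : ℝ) * (if y = ⟨x.1 + uvec μ, h⟩ then ψ y else 0) - (n : ℝ) * (if y = x then ψ y else 0) := by
      intro y
      have he : (y.1 = x.1 + uvec μ) ↔ (y = ⟨x.1 + uvec μ, h⟩) := by
        rw [Subtype.ext_iff]
      simp only [he]
      split_ifs <;> ring
    simp only [h1, Finset.sum_sub_distrib, ← Finset.mul_sum, Finset.sum_ite_eq', Finset.mem_univ, if_true]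
    ring
  · rw [fdiff_of_not_mem ψ h]
    simp only [fdiffM, mulVec, dotProduct, Matrix.of_apply, if_neg h, zero_mul, Finset.sum_const_zero]

/-- **THE TRANSPOSE `D_ν^⊤`** of the bond-restricted forward difference in the counting inner product — the operator
`D^{η*}_{0,ν}` of (2.30) (the adjoint in Bałaban's `η^{d+1}`-weighted `L²` is the same matrix, the weight being a
constant scalar). [cite: Balaban1983RegularityDecay, p. 580 (2.30), case A = 0, dictionary] [folklore] -/
def fdiffT (n : ℕ) (R : Finset (Fin (d + 1) → ℤ)) (ν : Fin (d + 1)) (ψ : ↥R → ℝ) : ↥R → ℝ :=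
  (fdiffM n R ν)ᵀ.mulVec ψ

/-- adjointness: `⟨u, D_ν^⊤ f'⟩ = ⟨D_ν u, f'⟩`. [folklore] -/
theorem dot_fdiffT (n : ℕ) (R : Finset (Fin (d + 1) → ℤ)) (ν : Fin (d + 1)) (u f' : ↥R → ℝ) :
    u ⬝ᵥ fdiffT n R ν f' = fdiff n R ν u ⬝ᵥ f' := by
  unfold fdiffT
  rw [Matrix.dotProduct_mulVec, Matrix.vecMul_transpose, fdiffM_mulVec]

/-- `D_μ 0 = 0`. [folklore] -/
theorem fdiff_zero (n : ℕ) (R : Finset (Fin (d + 1) → ℤ)) (μ : Fin (d + 1)) : fdiff n R μ (0 : ↥R → ℝ) = 0 := by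
  rw [← fdiffM_mulVec]; exact Matrix.mulVec_zero _

/-- `D_ν^⊤ 0 = 0`. [folklore] -/
theorem fdiffT_zero (n : ℕ) (R : Finset (Fin (d + 1) → ℤ)) (ν : Fin (d + 1)) : fdiffT n R ν (0 : ↥R → ℝ) = 0 :=
  Matrix.mulVec_zero _

/-- `x + e_μ` is a nearest neighbour of `x`. [folklore] -/
theorem add_uvec_mem_nbrs (x : Fin (d + 1) → ℤ) (μ : Fin (d + 1)) : x + uvec μ ∈ nbrs x :=
  mem_nbrs.2 ⟨μ, Or.inl rfl⟩

/-- the bonds of direction `μ` as a finite type: sources `x ∈ R` with `x + e_μ ∈ R`. [folklore] -/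
abbrev FBond (R : Finset (Fin (d + 1) → ℤ)) (μ : Fin (d + 1)) : Type := {x : ↥R // x.1 + uvec μ ∈ R}

/-- target of a `μ`-bond. [folklore] -/
def ftgt {R : Finset (Fin (d + 1) → ℤ)} {μ : Fin (d + 1)} (k : FBond R μ) : ↥R := ⟨k.1.1 + uvec μ, k.2⟩

/-- **THE SQUARED `μ`-GRADIENT IS DOMINATED BY THE FORM OF (1.6) AT `A = 0`**: for `a ≥ 0`, `m² ≥ 0`, every mesh and
every union `R` of `n`-blocks, `Σ_x (D_μ ω)(x)² ≤ ⟨ω, (n²(−Δ^N_R) + m² + (a/n^{d+1})1_{same block}) ω⟩` — the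
`A = 0`, general-region form of the computation (2.29) «‖∂^η_μG_k^{1/2}(□,0)f‖₂² = ⟨f, G_k^{1/2}(□,0)∂^{η*}_μ∂^η_μG_k^{1/2}(□,0)f⟩
≤ ⟨f, G_k^{1/2}(□,0)(−Δ^{η,N}_□ + m_k² + a_kP_k)G_k^{1/2}(□,0)f⟩ = ‖f‖₂²» (i.e. `∂^{η*}_μ∂^η_μ ≤ −Δ^{η,N} + m_k² + a_kP_k`).
[cite: Balaban1983RegularityDecay, p. 580 (2.29), case A = 0] [folklore] -/
theorem sum_fdiff_sq_le_form {n : ℕ} (hn : 1 ≤ n) {R : Finset (Fin (d + 1) → ℤ)} (hR : IsBlockUnion n R)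
    {a m2 : ℝ} (ha : 0 ≤ a) (hm : 0 ≤ m2) (μ : Fin (d + 1)) (ω : ↥R → ℝ) :
    ∑ x, fdiff n R μ ω x ^ 2 ≤ ω ⬝ᵥ (fineOpR n a m2 R).mulVec ω := by
  classical
  -- Step 1: the squared gradient as `n²` times the Dirichlet sum over the `μ`-bonds
  have h1 : ∑ x, fdiff n R μ ω x ^ 2 = (n : ℝ) ^ 2 * ∑ k : FBond R μ, (ω (ftgt k) - ω k.1) ^ 2 := by
    have h1a : ∑ x, fdiff n R μ ω x ^ 2
        = ∑ x ∈ Finset.univ.filter (fun x : ↥R => x.1 + uvec μ ∈ R),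
            (n : ℝ) ^ 2 * (extR ω (x.1 + uvec μ) - ω x) ^ 2 := by
      rw [Finset.sum_filter]
      refine Finset.sum_congr rfl fun x _ => ?_
      by_cases h : x.1 + uvec μ ∈ R
      · rw [if_pos h, fdiff, if_pos h]; ring
      · rw [if_neg h, fdiff_of_not_mem ω h]; ring
    rw [h1a, Finset.sum_subtype (Finset.univ.filter (fun x : ↥R => x.1 + uvec μ ∈ R)) (p := fun x : ↥R => x.1 + uvec μ ∈ R)
      (fun x => by simp), Finset.mul_sum]
    refine Finset.sum_congr rfl fun k _ => ?_
    rw [extR_of_mem ω k.2]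
    rfl
  -- Step 2: the Laplacian form dominates `n²` times the bond sum
  have h2 : (n : ℝ) ^ 2 * ∑ k : FBond R μ, (ω (ftgt k) - ω k.1) ^ 2
      ≤ (1 / 2 : ℝ) * ∑ j, ∑ k, adjC n R j k * (ω j - ω k) ^ 2 := by
    refine lap_form_ge_dirichlet (adjC n R) (adjC_symm n R) (adjC_nonneg n R) (fun k : FBond R μ => k.1) ftgt
      ((n : ℝ) ^ 2) (fun k => ?_) (fun k k' h => ?_) (fun k k' h => ?_) ω
    · have hk : (ftgt k).1 ∈ nbrs k.1.1 := add_uvec_mem_nbrs k.1.1 μ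
      simp only [adjC, hk, if_true, le_refl]
    · simp only [Prod.mk.injEq] at h
      exact Subtype.ext h.1
    · simp only [Prod.mk.injEq, ftgt] at h
      obtain ⟨h1, h2⟩ := h
      have h1' := congrArg Subtype.val h1
      have h2' := congrArg Subtype.val h2
      simp only at h1' h2'
      apply uvec_add_uvec_ne_zero μ μ
      have : k'.1.1 + (uvec μ + uvec μ) = k'.1.1 + 0 := by
        rw [← add_assoc, ← h1', h2', add_zero]
      exact add_left_cancel this
  -- Step 3: the Laplacian form is the Dirichlet part of `fineOpR_form`; the block and mass parts are `≥ 0`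
  have h3 : (1 / 2 : ℝ) * ∑ j, ∑ k, adjC n R j k * (ω j - ω k) ^ 2
      = (n : ℝ) ^ 2 / 2 * ∑ x : ↥R, ∑ y : ↥R, (if y.1 ∈ nbrs x.1 then (ω x - ω y) ^ 2 else 0) := by
    have : ∀ j k : ↥R, adjC n R j k * (ω j - ω k) ^ 2 = (n : ℝ) ^ 2 * (if k.1 ∈ nbrs j.1 then (ω j - ω k) ^ 2 else 0) := by
      intro j k
      unfold adjC
      split_ifs <;> ring
    simp_rw [this, ← Finset.mul_sum]
    ring
  rw [fineOpR_form hn hR a m2 ω, h1]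
  have hB : 0 ≤ a * ((n : ℝ) ^ (d + 1))⁻¹
      * ∑ b : ↥(R.image (blk n)), (∑ x ∈ Finset.univ.filter (fun x => rblk n R x = b), ω x) ^ 2 := by positivity
  have hM : 0 ≤ m2 * (ω ⬝ᵥ ω) := by
    have : 0 ≤ ω ⬝ᵥ ω := by simp only [dotProduct]; exact Finset.sum_nonneg fun j _ => mul_self_nonneg _
    positivity
  linarith [h2, h3]

/-- shifted squares are dominated by all squares: `Σ_{x∈S} w(x + e_μ)² ≤ Σ_y w(y)²` (the shift is injective).
[folklore] -/
theorem sum_sq_shift_le {R : Finset (Fin (d + 1) → ℤ)} (μ : Fin (d + 1)) (w : ↥R → ℝ) (S : Finset ↥R) :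
    ∑ x ∈ S, extR w (x.1 + uvec μ) ^ 2 ≤ ∑ y, w y ^ 2 := by
  classical
  set S' := S.filter (fun x : ↥R => x.1 + uvec μ ∈ R) with hS'
  set τ : ↥R → ↥R := fun x => if h : x.1 + uvec μ ∈ R then ⟨x.1 + uvec μ, h⟩ else x with hτ
  have h1 : ∑ x ∈ S, extR w (x.1 + uvec μ) ^ 2 = ∑ x ∈ S', w (τ x) ^ 2 := by
    rw [hS', Finset.sum_filter]
    refine Finset.sum_congr rfl fun x _ => ?_
    by_cases h : x.1 + uvec μ ∈ R
    · rw [if_pos h, extR_of_mem w h, hτ]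
      simp only [h, dif_pos]
    · rw [if_neg h, extR_of_not_mem w h]; ring
  have hinj : ∀ x ∈ S', ∀ y ∈ S', τ x = τ y → x = y := by
    intro x hx y hy hxy
    rw [hS', Finset.mem_filter] at hx hy
    simp only [hτ, hx.2, hy.2, dif_pos, Subtype.mk.injEq] at hxy
    exact Subtype.ext (add_right_cancel hxy)
  have h2 : ∑ x ∈ S', w (τ x) ^ 2 = ∑ y ∈ S'.image τ, w y ^ 2 :=
    (Finset.sum_image (f := fun y => w y ^ 2) hinj).symm
  rw [h1, h2]
  exact Finset.sum_le_sum_of_subset_of_nonneg (Finset.subset_univ _) fun y _ _ => sq_nonneg _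

/-! ## §C  The metric, the Combes–Thomas weight, and the two hypotheses of the abstract estimate for the operator
of (1.6) at `A = 0` WITH mass, on every union of blocks -/

section Metric

variable {n : ℕ} {R : Finset (Fin (d + 1) → ℤ)}

/-- `dist_η(x,x) = 0`. [folklore] -/
theorem edistR_self (x : ↥R) : edistR n R x x = 0 := by simp [edistR, supNorm_zero']

/-- `dist_η` is symmetric. [folklore] -/
theorem edistR_comm (x y : ↥R) : edistR n R x y = edistR n R y x := by
  simp only [edistR]
  rw [← B4TorusKernel.supNorm_neg, neg_sub]

/-- `dist_η` satisfies the triangle inequality. [folklore] -/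
theorem edistR_triangle (x y z : ↥R) : edistR n R x z ≤ edistR n R x y + edistR n R y z := by
  simp only [edistR]
  rw [← mul_add]
  refine mul_le_mul_of_nonneg_left ?_ (by positivity)
  have := supNorm_add_le (x.1 - y.1) (y.1 - z.1)
  rwa [sub_add_sub_cancel] at this

/-- `dist_η ≥ 0`. [folklore] -/
theorem edistR_nonneg (x y : ↥R) : 0 ≤ edistR n R x y := by
  unfold edistR
  have := supNorm_nonneg (x.1 - y.1)
  positivity

/-- a bond has `η`-length `≤ η = 1/n`. [folklore] -/
theorem edistR_step_le (x : ↥R) (μ : Fin (d + 1)) (h : x.1 + uvec μ ∈ R) :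
    edistR n R x ⟨x.1 + uvec μ, h⟩ ≤ 1 / (n : ℝ) := by
  unfold edistR
  calc (1 / (n : ℝ)) * supNorm (x.1 - (x.1 + uvec μ)) ≤ (1 / (n : ℝ)) * 1 :=
        mul_le_mul_of_nonneg_left (supNorm_sub_le_one_of_mem_nbrs (add_uvec_mem_nbrs x.1 μ)) (by positivity)
    _ = 1 / (n : ℝ) := mul_one _

end Metric

/-- **THE COMBES–THOMAS WEIGHT** `φ = δ · dist_η(·, T)` (distance to the source set in `η`-scaled sup-norm).
[cite: CombesThomas1973, §II] [folklore] -/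
def ctw (n : ℕ) (R : Finset (Fin (d + 1) → ℤ)) (δ : ℝ) (T : Finset ↥R) (hT : T.Nonempty) (j : ↥R) : ℝ :=
  δ * distTo (edistR n R) T hT j

section Weight

variable {n : ℕ} {R : Finset (Fin (d + 1) → ℤ)} {δ : ℝ}

/-- the Combes–Thomas weight is `≤ 0` on the source set `T`. [folklore] -/
theorem ctw_le_zero_of_mem (hδ : 0 ≤ δ) (T : Finset ↥R) (hT : T.Nonempty) {j : ↥R} (hj : j ∈ T) :
    ctw n R δ T hT j ≤ 0 :=
  mul_nonpos_iff.2 (Or.inl ⟨hδ, distTo_le_zero_of_mem (edistR n R) edistR_self T hT hj⟩)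

/-- the Combes–Thomas weight is `≥ δρ` at distance `≥ ρ` from `T`. [folklore] -/
theorem le_ctw (hδ : 0 ≤ δ) (T : Finset ↥R) (hT : T.Nonempty) {j : ↥R} {ρ : ℝ} (hρ : ∀ t ∈ T, ρ ≤ edistR n R j t) :
    δ * ρ ≤ ctw n R δ T hT j :=
  mul_le_mul_of_nonneg_left (le_distTo (edistR n R) T hT hρ) hδ

/-- the Combes–Thomas weight is `δ`-Lipschitz for `dist_η`. [folklore] -/
theorem abs_ctw_sub_le (hδ : 0 ≤ δ) (T : Finset ↥R) (hT : T.Nonempty) (j k : ↥R) :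
    |ctw n R δ T hT j - ctw n R δ T hT k| ≤ δ * edistR n R j k := by
  unfold ctw
  rw [← mul_sub, abs_mul, abs_of_nonneg hδ]
  exact mul_le_mul_of_nonneg_left (abs_distTo_sub_le (edistR n R) edistR_comm edistR_triangle T hT j k) hδ

/-- across a bond the weight oscillates by at most `δη = δ/n`. [folklore] -/
theorem abs_ctw_step_le (hδ : 0 ≤ δ) (T : Finset ↥R) (hT : T.Nonempty) (x : ↥R) (μ : Fin (d + 1))
    (h : x.1 + uvec μ ∈ R) : |ctw n R δ T hT ⟨x.1 + uvec μ, h⟩ - ctw n R δ T hT x| ≤ δ / (n : ℝ) := by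
  rw [abs_sub_comm]
  calc |ctw n R δ T hT x - ctw n R δ T hT ⟨x.1 + uvec μ, h⟩| ≤ δ * edistR n R x ⟨x.1 + uvec μ, h⟩ :=
        abs_ctw_sub_le hδ T hT _ _
    _ ≤ δ * (1 / (n : ℝ)) := mul_le_mul_of_nonneg_left (edistR_step_le x μ h) hδ
    _ = δ / (n : ℝ) := by ring

end Weight

/-- `n|e^t − 1| ≤ 2δ` for `|t| ≤ δ/n ≤ 1/n`, `n ≥ 1` — the first-order size of the conjugated bond coefficient, uniform in
the mesh. [folklore] -/
theorem nat_mul_abs_exp_sub_one_le {n : ℕ} (hn : 1 ≤ n) {δ t : ℝ} (hδ1 : δ ≤ 1) (ht : |t| ≤ δ / (n : ℝ)) :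
    (n : ℝ) * |Real.exp t - 1| ≤ 2 * δ := by
  have hn0 : (0 : ℝ) < n := by exact_mod_cast hn
  have hn1 : (1 : ℝ) ≤ n := by exact_mod_cast hn
  have ht1 : |t| ≤ 1 := by
    calc |t| ≤ δ / (n : ℝ) := ht
      _ ≤ 1 / 1 := by
          refine div_le_div₀ zero_le_one hδ1 one_pos hn1
      _ = 1 := by norm_num
  have h1 : |Real.exp t - 1 - t| ≤ t ^ 2 := Real.abs_exp_sub_one_sub_id_le ht1
  have h2 : |Real.exp t - 1| ≤ |t| + t ^ 2 := by
    have := abs_add_le (Real.exp t - 1 - t) t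
    rw [sub_add_cancel] at this
    linarith
  have h3 : t ^ 2 ≤ |t| := by
    rw [← sq_abs]
    calc |t| ^ 2 = |t| * |t| := sq _
      _ ≤ |t| * 1 := mul_le_mul_of_nonneg_left ht1 (abs_nonneg t)
      _ = |t| := mul_one _
  have h4 : (n : ℝ) * |t| ≤ δ := by
    have := mul_le_mul_of_nonneg_left ht hn0.le
    rwa [mul_div_cancel₀ _ hn0.ne'] at this
  calc (n : ℝ) * |Real.exp t - 1| ≤ (n : ℝ) * (|t| + t ^ 2) := mul_le_mul_of_nonneg_left h2 hn0.le
    _ ≤ (n : ℝ) * (|t| + |t|) := mul_le_mul_of_nonneg_left (add_le_add le_rfl h3) hn0.le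
    _ = 2 * ((n : ℝ) * |t|) := by ring
    _ ≤ 2 * δ := by linarith

section Leibniz

variable {n : ℕ} {R : Finset (Fin (d + 1) → ℤ)}

/-- **WEIGHTED LEIBNIZ RULE, source side**: if the weight oscillates by `≤ δ/n` across bonds then
`|(D_ν (e^{φ} w))(x)| ≤ e^{φ(x)} (|(D_ν w)(x)| + 2δ |w(x + e_ν)|)`. [folklore] -/
theorem abs_fdiff_weighted_le (hn : 1 ≤ n) {δ : ℝ} (hδ1 : δ ≤ 1) (φ w u : ↥R → ℝ)
    (hu : ∀ j, u j = Real.exp (φ j) * w j) (ν : Fin (d + 1))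
    (hLip : ∀ (x : ↥R) (h : x.1 + uvec ν ∈ R), |φ ⟨x.1 + uvec ν, h⟩ - φ x| ≤ δ / (n : ℝ)) (x : ↥R) :
    |fdiff n R ν u x| ≤ Real.exp (φ x) * (|fdiff n R ν w x| + 2 * δ * |extR w (x.1 + uvec ν)|) := by
  by_cases h : x.1 + uvec ν ∈ R
  · rw [fdiff_of_mem u h, fdiff_of_mem w h, extR_of_mem w h, hu, hu]
    set x' : ↥R := ⟨x.1 + uvec ν, h⟩ with hx'
    have hexp : Real.exp (φ x') = Real.exp (φ x) * Real.exp (φ x' - φ x) := by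
      rw [← Real.exp_add]; ring_nf
    have hid : (n : ℝ) * (Real.exp (φ x') * w x' - Real.exp (φ x) * w x)
        = Real.exp (φ x) * ((n : ℝ) * (w x' - w x) + (n : ℝ) * (Real.exp (φ x' - φ x) - 1) * w x') := by
      rw [hexp]; ring
    rw [hid, abs_mul, abs_of_pos (Real.exp_pos _)]
    refine mul_le_mul_of_nonneg_left ?_ (Real.exp_pos _).le
    have hc : |(n : ℝ) * (Real.exp (φ x' - φ x) - 1) * w x'| ≤ 2 * δ * |w x'| := by
      rw [abs_mul, abs_mul, abs_of_nonneg (by positivity : (0 : ℝ) ≤ n)]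
      exact mul_le_mul_of_nonneg_right (nat_mul_abs_exp_sub_one_le hn hδ1 (hLip x h)) (abs_nonneg _)
    calc |(n : ℝ) * (w x' - w x) + (n : ℝ) * (Real.exp (φ x' - φ x) - 1) * w x'|
        ≤ |(n : ℝ) * (w x' - w x)| + |(n : ℝ) * (Real.exp (φ x' - φ x) - 1) * w x'| := abs_add_le _ _
      _ ≤ |(n : ℝ) * (w x' - w x)| + 2 * δ * |w x'| := add_le_add le_rfl hc
  · rw [fdiff_of_not_mem u h, fdiff_of_not_mem w h, extR_of_not_mem w h, abs_zero]
    simp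

/-- **WEIGHTED LEIBNIZ RULE, observation side**: with `w = e^{φ} v`,
`e^{φ(x)} |(D_μ v)(x)| ≤ |(D_μ w)(x)| + 2δ |w(x + e_μ)|`. [folklore] -/
theorem exp_mul_abs_fdiff_le (hn : 1 ≤ n) {δ : ℝ} (hδ1 : δ ≤ 1) (φ v w : ↥R → ℝ)
    (hw : ∀ j, w j = Real.exp (φ j) * v j) (μ : Fin (d + 1))
    (hLip : ∀ (x : ↥R) (h : x.1 + uvec μ ∈ R), |φ ⟨x.1 + uvec μ, h⟩ - φ x| ≤ δ / (n : ℝ)) (x : ↥R) :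
    Real.exp (φ x) * |fdiff n R μ v x| ≤ |fdiff n R μ w x| + 2 * δ * |extR w (x.1 + uvec μ)| := by
  by_cases h : x.1 + uvec μ ∈ R
  · rw [fdiff_of_mem v h, fdiff_of_mem w h, extR_of_mem w h, hw, hw]
    set x' : ↥R := ⟨x.1 + uvec μ, h⟩ with hx'
    have hexp : Real.exp (φ x) = Real.exp (φ x - φ x') * Real.exp (φ x') := by
      rw [← Real.exp_add]; ring_nf
    have hid : Real.exp (φ x) * ((n : ℝ) * (v x' - v x))
        = (n : ℝ) * (Real.exp (φ x') * v x' - Real.exp (φ x) * v x)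
          + (n : ℝ) * (Real.exp (φ x - φ x') - 1) * (Real.exp (φ x') * v x') := by
      rw [hexp]; ring
    have hlhs : Real.exp (φ x) * |(n : ℝ) * (v x' - v x)| = |Real.exp (φ x) * ((n : ℝ) * (v x' - v x))| := by
      rw [abs_mul (Real.exp (φ x)), abs_of_pos (Real.exp_pos _)]
    rw [hlhs, hid]
    have hc : |(n : ℝ) * (Real.exp (φ x - φ x') - 1) * (Real.exp (φ x') * v x')|
        ≤ 2 * δ * |Real.exp (φ x') * v x'| := by
      rw [abs_mul ((n : ℝ) * _), abs_mul (n : ℝ), abs_of_nonneg (by positivity : (0 : ℝ) ≤ n)]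
      refine mul_le_mul_of_nonneg_right (nat_mul_abs_exp_sub_one_le hn hδ1 ?_) (abs_nonneg _)
      rw [abs_sub_comm]; exact hLip x h
    calc |(n : ℝ) * (Real.exp (φ x') * v x' - Real.exp (φ x) * v x)
          + (n : ℝ) * (Real.exp (φ x - φ x') - 1) * (Real.exp (φ x') * v x')|
        ≤ |(n : ℝ) * (Real.exp (φ x') * v x' - Real.exp (φ x) * v x)|
          + |(n : ℝ) * (Real.exp (φ x - φ x') - 1) * (Real.exp (φ x') * v x')| := abs_add_le _ _
      _ ≤ _ := add_le_add le_rfl hc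
  · rw [fdiff_of_not_mem v h, fdiff_of_not_mem w h, extR_of_not_mem w h, abs_zero, mul_zero]
    simp

end Leibniz

section Hypotheses

variable {n : ℕ} {R : Finset (Fin (d + 1) → ℤ)}

/-- **COERCIVITY WITH MASS**: `min(2,a)‖ω‖² ≤ ⟨ω, (n²(−Δ^N_R) + m² + (a/n^{d+1})1_{same block})ω⟩` for `a ≥ 0`, `m² ≥ 0`
(B4 (1.8) at `A = 0`, `B4Lower18.lower18`, dropping the mass). [cite: Balaban1983RegularityDecay, p. 573 (1.8), case A = 0] -/
theorem hpos_region (hn : 1 ≤ n) (hR : IsBlockUnion n R) {a m2 : ℝ} (ha : 0 ≤ a) (hm : 0 ≤ m2) (ω : ↥R → ℝ) :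
    min 2 a * (ω ⬝ᵥ ω) ≤ ω ⬝ᵥ (fineOpR n a m2 R).mulVec ω := by
  have h := lower18 hn ha m2 hR ω
  have h0 : 0 ≤ ω ⬝ᵥ ω := by simp only [dotProduct]; exact Finset.sum_nonneg fun j _ => mul_self_nonneg _
  nlinarith

/-- **THE CONJUGATION-ERROR BOUND FOR THE MASSIVE OPERATOR, UNIFORMLY IN THE MESH AND THE REGION**: with the
weight `φ = δ·dist_η(·,T)`, `0 ≤ δ ≤ 1` and the `η`-free smallness `2(d+1)δ² + a(e^δ − 1) ≤ min(2,a)/2`, for every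
`m²` (the mass is diagonal, so it does not contribute to the conjugation error):
`−(min(2,a)/2)‖w‖² ≤ Σ_{j,k} (e^{φ_j − φ_k} − 1) H_jk w_j w_k`. [cite: CombesThomas1973, §II] [folklore] -/
theorem herr_region (hn : 1 ≤ n) (hR : IsBlockUnion n R) {a δ : ℝ} (m2 : ℝ) (ha : 0 < a) (hδ0 : 0 ≤ δ)
    (hδ1 : δ ≤ 1) (hsmall : 2 * ((d : ℝ) + 1) * δ ^ 2 + a * (Real.exp δ - 1) ≤ min 2 a / 2)
    (T : Finset ↥R) (hT : T.Nonempty) (w : ↥R → ℝ) :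
    -(min 2 a / 2) * (w ⬝ᵥ w)
      ≤ ∑ j, ∑ k, (Real.exp (ctw n R δ T hT j - ctw n R δ T hT k) - 1) * fineOpR n a m2 R j k * (w j * w k) := by
  classical
  have hn0 : (0 : ℝ) < n := by exact_mod_cast hn
  have hn1 : (1 : ℝ) ≤ n := by exact_mod_cast hn
  have hη : (0 : ℝ) < 1 / (n : ℝ) := by positivity
  have hη1 : 1 / (n : ℝ) ≤ 1 := by rw [div_le_one hn0]; exact hn1
  set φ : ↥R → ℝ := ctw n R δ T hT with hφ
  -- the mass term is diagonal and drops out of the conjugation error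
  have hsplit : ∑ j, ∑ k, (Real.exp (φ j - φ k) - 1) * fineOpR n a m2 R j k * (w j * w k)
      = ∑ j, ∑ k, (Real.exp (φ j - φ k) - 1) * fineOpR n a 0 R j k * (w j * w k) := by
    refine Finset.sum_congr rfl fun j _ => Finset.sum_congr rfl fun k _ => ?_
    rw [fineOpR_eq_add_smul n a m2 R, Matrix.add_apply, Matrix.smul_apply, Matrix.one_apply, smul_eq_mul]
    by_cases hjk : j = k
    · subst hjk; simp
    · simp [hjk]
  rw [hsplit]
  -- the massless operator has the shape `lap c + Σ_b m_b u_b ⊗ u_b`; add the two defect bounds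
  have hcard : ∀ b : ↥(R.image (blk n)), ((Finset.univ.filter fun i => rblk n R i = b).card : ℝ) = (n : ℝ) ^ (d + 1) := by
    intro b
    rw [card_filter_rblk hn hR b]
    push_cast
    rfl
  have hlip : ∀ j k : ↥R, |φ j - φ k| ≤ δ * edistR n R j k := fun j k => abs_ctw_sub_le hδ0 T hT j k
  have hc : ∀ j k : ↥R, adjC n R j k ≠ 0 → adjC n R j k = ((1 / (n : ℝ)) ^ 2)⁻¹ ∧ |φ j - φ k| ≤ δ * (1 / (n : ℝ)) := by
    intro j k hjk
    have hadj : k.1 ∈ nbrs j.1 := by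
      by_contra h
      exact hjk (if_neg h)
    refine ⟨?_, ?_⟩
    · simp only [adjC, hadj, if_true]
      field_simp
    · refine (hlip j k).trans (mul_le_mul_of_nonneg_left ?_ hδ0)
      show (1 / (n : ℝ)) * supNorm (j.1 - k.1) ≤ 1 / (n : ℝ)
      calc (1 / (n : ℝ)) * supNorm (j.1 - k.1) ≤ (1 / (n : ℝ)) * 1 :=
            mul_le_mul_of_nonneg_left (supNorm_sub_le_one_of_mem_nbrs hadj) hη.le
        _ = 1 / (n : ℝ) := mul_one _
  have hδη : δ * (1 / (n : ℝ)) ≤ 1 := by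
    calc δ * (1 / (n : ℝ)) ≤ 1 * 1 := mul_le_mul hδ1 hη1 hη.le zero_le_one
      _ = 1 := one_mul 1
  have hΘ : ∀ j k : ↥R, rblk n R j = rblk n R k → |φ j - φ k| ≤ δ := by
    intro j k hjk
    have hb : blk n j.1 = blk n k.1 := congrArg Subtype.val hjk
    refine (hlip j k).trans ?_
    have hd : edistR n R j k ≤ 1 := by
      show (1 / (n : ℝ)) * supNorm (j.1 - k.1) ≤ 1
      calc (1 / (n : ℝ)) * supNorm (j.1 - k.1) ≤ (1 / (n : ℝ)) * ((n : ℝ) - 1) :=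
            mul_le_mul_of_nonneg_left (supNorm_sub_le_of_blk_eq hn hb) hη.le
        _ ≤ 1 := by rw [div_mul_eq_mul_div, one_mul, div_le_one hn0]; linarith
    calc δ * edistR n R j k ≤ δ * 1 := mul_le_mul_of_nonneg_left hd hδ0
      _ = δ := mul_one δ
  have hε0 : 0 ≤ Real.exp δ - 1 := by linarith [Real.add_one_le_exp δ]
  have hκQ : ∀ b : ↥(R.image (blk n)),
      a / ((Finset.univ.filter fun i => rblk n R i = b).card : ℝ) * (Real.exp δ - 1)
        * ∑ k : ↥R, (if rblk n R k = b then (1 : ℝ) else 0) ^ 2 ≤ a * (Real.exp δ - 1) := by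
    intro b
    have hsq : ∑ k : ↥R, (if rblk n R k = b then (1 : ℝ) else 0) ^ 2
        = ((Finset.univ.filter fun i => rblk n R i = b).card : ℝ) := by
      simp_rw [ite_pow, one_pow, zero_pow two_ne_zero]
      rw [Finset.sum_boole]
    rw [hsq, hcard]
    have hpow : ((n : ℝ) ^ (d + 1)) ≠ 0 := by positivity
    rw [mul_assoc, mul_comm (Real.exp δ - 1), ← mul_assoc, div_mul_cancel₀ a hpow]
  have h := conjError_lap_add_blocks_ge (adjC n R) (adjC_symm n R) (adjC_nonneg n R) (rblk n R)
    (fun b => a / ((Finset.univ.filter fun i => rblk n R i = b).card : ℝ))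
    (fun b => div_nonneg ha.le (Nat.cast_nonneg _))
    (fun b j => if rblk n R j = b then (1 : ℝ) else 0) (fun b j hj => if_neg hj)
    (fineOpR n a 0 R) (fineOpR_zero_eq hn hR a) φ (2 * ((d : ℝ) + 1) * δ ^ 2) (a * (Real.exp δ - 1))
    (lapDefect_le (adjC n R) φ hη hδη hc (fun j => card_filter_adjC_ne_zero_le n R j))
    (fun _ => Real.exp δ - 1) (fun _ => hε0)
    (fun b j k hj hk => blockDefect_le (rblk n R) φ δ hΘ b j k hj hk) hκQ w
  have hww : 0 ≤ w ⬝ᵥ w := by simp only [dotProduct]; exact Finset.sum_nonneg fun j _ => mul_self_nonneg _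
  nlinarith

/-- **`G_k(Ω,0)` is a genuine inverse with mass**: `H·(H⁻¹ g) = g` for `a > 0`, `m² ≥ 0`. [folklore] -/
theorem mulVec_inv_mulVec (hn : 1 ≤ n) (hR : IsBlockUnion n R) {a m2 : ℝ} (ha : 0 < a) (hm : 0 ≤ m2)
    (g : ↥R → ℝ) : (fineOpR n a m2 R).mulVec ((fineOpR n a m2 R)⁻¹.mulVec g) = g := by
  have hpos : 0 < min 2 a + m2 := by
    have : 0 < min 2 a := lt_min (by norm_num) ha
    linarith
  rw [Matrix.mulVec_mulVec, fineOpR_mul_inv hn ha.le hpos hR, Matrix.one_mulVec]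

/-- `G` is symmetric: `⟨f, G g⟩ = ⟨G f, g⟩`. [folklore] -/
theorem dot_inv_mulVec_comm (n : ℕ) (R : Finset (Fin (d + 1) → ℤ)) (a m2 : ℝ) (f g : ↥R → ℝ) :
    f ⬝ᵥ (fineOpR n a m2 R)⁻¹.mulVec g = (fineOpR n a m2 R)⁻¹.mulVec f ⬝ᵥ g := by
  have hsym : ((fineOpR n a m2 R)⁻¹)ᵀ = (fineOpR n a m2 R)⁻¹ := by
    rw [Matrix.transpose_nonsing_inv, (fineOpR_isSymm n a m2 R).eq]
  rw [Matrix.dotProduct_mulVec, ← Matrix.mulVec_transpose, hsym]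

end Hypotheses

/-! ## §D  The two energy bounds and the four set-to-set decay estimates, uniformly in the mesh and the region -/

section Decay

variable {n : ℕ} {R : Finset (Fin (d + 1) → ℤ)}

/-- `⟨w,w⟩ = Σ w²`. [folklore] -/
theorem dotProduct_self_eq_sum_sq (w : ↥R → ℝ) : w ⬝ᵥ w = ∑ j, w j ^ 2 := by
  simp only [dotProduct, sq]

/-- `0 ≤ ⟨w,w⟩`. [folklore] -/
theorem dotProduct_self_nonneg' (w : ↥R → ℝ) : 0 ≤ w ⬝ᵥ w := by
  rw [dotProduct_self_eq_sum_sq]; exact Finset.sum_nonneg fun j _ => sq_nonneg _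

/-- **ENERGY BOUND, CASE A (source supported in `T`)**: with `v = G g`, `supp g ⊆ T`, `w = e^{φ} v`,
`φ = δ·dist_η(·,T)`: `⟨w, Hw⟩ ≤ (4/min(2,a))·‖g‖²`. [cite: CombesThomas1973, §II] [folklore] -/
theorem energyA (hn : 1 ≤ n) (hR : IsBlockUnion n R) {a m2 δ : ℝ} (ha : 0 < a) (hm : 0 ≤ m2) (hδ0 : 0 ≤ δ)
    (hδ1 : δ ≤ 1) (hsmall : 2 * ((d : ℝ) + 1) * δ ^ 2 + a * (Real.exp δ - 1) ≤ min 2 a / 2)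
    (T : Finset ↥R) (hT : T.Nonempty) (g : ↥R → ℝ) (hg : ∀ j, j ∉ T → g j = 0) (w : ↥R → ℝ)
    (hw : ∀ j, w j = Real.exp (ctw n R δ T hT j) * ((fineOpR n a m2 R)⁻¹.mulVec g) j) :
    w ⬝ᵥ (fineOpR n a m2 R).mulVec w ≤ 4 / min 2 a * ∑ j, g j ^ 2 := by
  have hσ : 0 < min 2 a := lt_min (by norm_num) ha
  have hv : (fineOpR n a m2 R).mulVec ((fineOpR n a m2 R)⁻¹.mulVec g) = g := mulVec_inv_mulVec hn hR ha hm g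
  have hE2P := energy_le_two_conjPairing (fineOpR n a m2 R) (min 2 a) (ctw n R δ T hT)
    (hpos_region hn hR ha.le hm) (herr_region hn hR m2 ha hδ0 hδ1 hsmall T hT) _ w hw
  rw [hv] at hE2P
  have hposw := hpos_region hn hR ha.le hm w
  have hww := dotProduct_self_nonneg' w
  have hE0 : 0 ≤ w ⬝ᵥ (fineOpR n a m2 R).mulVec w := le_trans (mul_nonneg hσ.le hww) hposw
  have hG : ∑ j, (Real.exp (ctw n R δ T hT j) * g j) ^ 2 ≤ ∑ j, g j ^ 2 := by
    have := weightedSq_le_of_support (ctw n R δ T hT) g T 0 hg (fun j hj => ctw_le_zero_of_mem hδ0 T hT hj)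
    simpa using this
  have hP2 : (∑ j, w j * (Real.exp (ctw n R δ T hT j) * g j)) ^ 2
      ≤ (∑ j, g j ^ 2) / min 2 a * (w ⬝ᵥ (fineOpR n a m2 R).mulVec w) := by
    calc (∑ j, w j * (Real.exp (ctw n R δ T hT j) * g j)) ^ 2
        ≤ (∑ j, w j ^ 2) * ∑ j, (Real.exp (ctw n R δ T hT j) * g j) ^ 2 := sq_sum_mul_le _ _ _
      _ ≤ (w ⬝ᵥ w) * ∑ j, g j ^ 2 := by
          rw [dotProduct_self_eq_sum_sq]
          exact mul_le_mul_of_nonneg_left hG (Finset.sum_nonneg fun j _ => sq_nonneg _)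
      _ ≤ (w ⬝ᵥ (fineOpR n a m2 R).mulVec w / min 2 a) * ∑ j, g j ^ 2 := by
          refine mul_le_mul_of_nonneg_right ?_ (Finset.sum_nonneg fun j _ => sq_nonneg _)
          rw [le_div_iff₀ hσ, mul_comm]; exact hposw
      _ = (∑ j, g j ^ 2) / min 2 a * (w ⬝ᵥ (fineOpR n a m2 R).mulVec w) := by ring
  have h := le_four_mul_of_sq_le hE0 (by positivity) hE2P hP2
  calc w ⬝ᵥ (fineOpR n a m2 R).mulVec w ≤ 4 * ((∑ j, g j ^ 2) / min 2 a) := h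
    _ = 4 / min 2 a * ∑ j, g j ^ 2 := by ring

/-- **ENERGY BOUND, CASE B (source `D_ν^⊤ f'`, `supp f' ⊆ T`)** — the pairing-form estimate that never sees
`‖D^⊤f'‖ ∼ n‖f'‖`: with `v = G D_ν^⊤ f'`, `w = e^{φ} v`: `⟨w, Hw⟩ ≤ 8(1 + 4δ²/min(2,a))·‖f'‖²`.
[cite: CombesThomas1973, §II] [folklore] -/
theorem energyB (hn : 1 ≤ n) (hR : IsBlockUnion n R) {a m2 δ : ℝ} (ha : 0 < a) (hm : 0 ≤ m2) (hδ0 : 0 ≤ δ)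
    (hδ1 : δ ≤ 1) (hsmall : 2 * ((d : ℝ) + 1) * δ ^ 2 + a * (Real.exp δ - 1) ≤ min 2 a / 2)
    (T : Finset ↥R) (hT : T.Nonempty) (ν : Fin (d + 1)) (f' : ↥R → ℝ) (hf' : ∀ j, j ∉ T → f' j = 0)
    (w : ↥R → ℝ)
    (hw : ∀ j, w j = Real.exp (ctw n R δ T hT j) * ((fineOpR n a m2 R)⁻¹.mulVec (fdiffT n R ν f')) j) :
    w ⬝ᵥ (fineOpR n a m2 R).mulVec w ≤ 8 * (1 + 4 * δ ^ 2 / min 2 a) * ∑ j, f' j ^ 2 := by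
  classical
  have hσ : 0 < min 2 a := lt_min (by norm_num) ha
  set φ := ctw n R δ T hT with hφ
  set H := fineOpR n a m2 R with hH
  have hv : H.mulVec (H⁻¹.mulVec (fdiffT n R ν f')) = fdiffT n R ν f' := mulVec_inv_mulVec hn hR ha hm _
  have hE2P := energy_le_two_conjPairing H (min 2 a) φ (hpos_region hn hR ha.le hm)
    (herr_region hn hR m2 ha hδ0 hδ1 hsmall T hT) _ w hw
  rw [hv] at hE2P
  have hposw := hpos_region hn hR ha.le hm w
  have hww := dotProduct_self_nonneg' w
  have hE0 : 0 ≤ w ⬝ᵥ H.mulVec w := le_trans (mul_nonneg hσ.le hww) hposw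
  -- the conjugated pairing as `⟨D_ν(e^{φ} w), f'⟩`
  set u : ↥R → ℝ := fun j => Real.exp (φ j) * w j with hu
  have hPeq : ∑ j, w j * (Real.exp (φ j) * fdiffT n R ν f' j) = ∑ x ∈ T, f' x * fdiff n R ν u x := by
    have h1 : ∑ j, w j * (Real.exp (φ j) * fdiffT n R ν f' j) = u ⬝ᵥ fdiffT n R ν f' := by
      simp only [dotProduct, hu]
      exact Finset.sum_congr rfl fun j _ => by ring
    rw [h1, dot_fdiffT]
    simp only [dotProduct]
    rw [← Finset.sum_subset (Finset.subset_univ T)]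
    · exact Finset.sum_congr rfl fun x _ => mul_comm _ _
    · intro x _ hx
      rw [hf' x hx, mul_zero]
  rw [hPeq] at hE2P
  -- pointwise Leibniz bound on `T` (where `φ ≤ 0`)
  have hLip : ∀ (x : ↥R) (h : x.1 + uvec ν ∈ R), |φ ⟨x.1 + uvec ν, h⟩ - φ x| ≤ δ / (n : ℝ) :=
    fun x h => abs_ctw_step_le hδ0 T hT x ν h
  have hUx : ∀ x ∈ T, fdiff n R ν u x ^ 2
      ≤ 2 * (fdiff n R ν w x ^ 2 + 4 * δ ^ 2 * extR w (x.1 + uvec ν) ^ 2) := by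
    intro x hx
    have h1 := abs_fdiff_weighted_le hn hδ1 φ w u (fun j => rfl) ν hLip x
    have h2 : Real.exp (φ x) ≤ 1 := by
      rw [← Real.exp_zero]
      exact Real.exp_le_exp.2 (ctw_le_zero_of_mem hδ0 T hT hx)
    have h3 : 0 ≤ |fdiff n R ν w x| + 2 * δ * |extR w (x.1 + uvec ν)| := by positivity
    have h4 : |fdiff n R ν u x| ≤ |fdiff n R ν w x| + 2 * δ * |extR w (x.1 + uvec ν)| :=
      h1.trans ((mul_le_mul_of_nonneg_right h2 h3).trans (by rw [one_mul]))
    have h5 : fdiff n R ν u x ^ 2 ≤ (|fdiff n R ν w x| + 2 * δ * |extR w (x.1 + uvec ν)|) ^ 2 := by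
      rw [← sq_abs (fdiff n R ν u x)]
      exact pow_le_pow_left₀ (abs_nonneg _) h4 2
    have h6 : (|fdiff n R ν w x| + 2 * δ * |extR w (x.1 + uvec ν)|) ^ 2
        ≤ 2 * (|fdiff n R ν w x| ^ 2 + (2 * δ * |extR w (x.1 + uvec ν)|) ^ 2) := by
      nlinarith [sq_nonneg (|fdiff n R ν w x| - 2 * δ * |extR w (x.1 + uvec ν)|)]
    calc fdiff n R ν u x ^ 2 ≤ _ := h5
      _ ≤ _ := h6
      _ = 2 * (fdiff n R ν w x ^ 2 + 4 * δ ^ 2 * extR w (x.1 + uvec ν) ^ 2) := by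
          rw [sq_abs, mul_pow, mul_pow, sq_abs]; ring
  have hDw : ∑ x, fdiff n R ν w x ^ 2 ≤ w ⬝ᵥ H.mulVec w := sum_fdiff_sq_le_form hn hR ha.le hm ν w
  have hshift : ∑ x ∈ T, extR w (x.1 + uvec ν) ^ 2 ≤ w ⬝ᵥ w := by
    rw [dotProduct_self_eq_sum_sq]; exact sum_sq_shift_le ν w T
  have hwwE : w ⬝ᵥ w ≤ w ⬝ᵥ H.mulVec w / min 2 a := by
    rw [le_div_iff₀ hσ, mul_comm]; exact hposw
  have hDT : ∑ x ∈ T, fdiff n R ν w x ^ 2 ≤ ∑ x, fdiff n R ν w x ^ 2 :=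
    Finset.sum_le_sum_of_subset_of_nonneg (Finset.subset_univ T) fun x _ _ => sq_nonneg _
  have hU : ∑ x ∈ T, fdiff n R ν u x ^ 2 ≤ 2 * (1 + 4 * δ ^ 2 / min 2 a) * (w ⬝ᵥ H.mulVec w) := by
    calc ∑ x ∈ T, fdiff n R ν u x ^ 2
        ≤ ∑ x ∈ T, 2 * (fdiff n R ν w x ^ 2 + 4 * δ ^ 2 * extR w (x.1 + uvec ν) ^ 2) :=
          Finset.sum_le_sum hUx
      _ = ∑ x ∈ T, (2 * fdiff n R ν w x ^ 2 + 8 * δ ^ 2 * extR w (x.1 + uvec ν) ^ 2) :=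
          Finset.sum_congr rfl fun x _ => by ring
      _ = 2 * ∑ x ∈ T, fdiff n R ν w x ^ 2 + 8 * δ ^ 2 * ∑ x ∈ T, extR w (x.1 + uvec ν) ^ 2 := by
          rw [Finset.sum_add_distrib, Finset.mul_sum, Finset.mul_sum]
      _ ≤ 2 * (w ⬝ᵥ H.mulVec w) + 8 * δ ^ 2 * (w ⬝ᵥ H.mulVec w / min 2 a) :=
          add_le_add (mul_le_mul_of_nonneg_left (hDT.trans hDw) (by norm_num))
            (mul_le_mul_of_nonneg_left (hshift.trans hwwE) (by positivity))
      _ = 2 * (1 + 4 * δ ^ 2 / min 2 a) * (w ⬝ᵥ H.mulVec w) := by ring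
  have hP2 : (∑ x ∈ T, f' x * fdiff n R ν u x) ^ 2
      ≤ 2 * (1 + 4 * δ ^ 2 / min 2 a) * (∑ j, f' j ^ 2) * (w ⬝ᵥ H.mulVec w) := by
    have hf'T : ∑ x ∈ T, f' x ^ 2 ≤ ∑ j, f' j ^ 2 :=
      Finset.sum_le_sum_of_subset_of_nonneg (Finset.subset_univ T) fun x _ _ => sq_nonneg _
    calc (∑ x ∈ T, f' x * fdiff n R ν u x) ^ 2 ≤ (∑ x ∈ T, f' x ^ 2) * ∑ x ∈ T, fdiff n R ν u x ^ 2 :=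
          sq_sum_mul_le T _ _
      _ ≤ (∑ j, f' j ^ 2) * (2 * (1 + 4 * δ ^ 2 / min 2 a) * (w ⬝ᵥ H.mulVec w)) :=
          mul_le_mul hf'T hU (Finset.sum_nonneg fun x _ => sq_nonneg _) (Finset.sum_nonneg fun x _ => sq_nonneg _)
      _ = 2 * (1 + 4 * δ ^ 2 / min 2 a) * (∑ j, f' j ^ 2) * (w ⬝ᵥ H.mulVec w) := by ring
  have h := le_four_mul_of_sq_le hE0 (by positivity) hE2P hP2
  calc w ⬝ᵥ H.mulVec w ≤ 4 * (2 * (1 + 4 * δ ^ 2 / min 2 a) * ∑ j, f' j ^ 2) := h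
    _ = 8 * (1 + 4 * δ ^ 2 / min 2 a) * ∑ j, f' j ^ 2 := by ring

/-- **VALUES ON `S` FROM THE ENERGY**: `Σ_{x∈S} v(x)² ≤ e^{−2δρ}‖w‖² ≤ e^{−2δρ}⟨w,Hw⟩/min(2,a)` when
`dist_η(S,T) ≥ ρ`. [folklore] -/
theorem sum_sq_le_energy (hn : 1 ≤ n) (hR : IsBlockUnion n R) {a m2 δ : ℝ} (ha : 0 < a) (hm : 0 ≤ m2)
    (hδ0 : 0 ≤ δ) (T : Finset ↥R) (hT : T.Nonempty) (S : Finset ↥R) (ρ : ℝ)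
    (hρ : ∀ x ∈ S, ∀ t ∈ T, ρ ≤ edistR n R x t) (v w : ↥R → ℝ)
    (hw : ∀ j, w j = Real.exp (ctw n R δ T hT j) * v j) :
    ∑ x ∈ S, v x ^ 2 ≤ Real.exp (-(2 * (δ * ρ))) / min 2 a * (w ⬝ᵥ (fineOpR n a m2 R).mulVec w) := by
  have hσ : 0 < min 2 a := lt_min (by norm_num) ha
  have h1 := setSq_le_of_weightedSq (ctw n R δ T hT) v S (δ * ρ)
    (fun x hx => le_ctw hδ0 T hT (fun t ht => hρ x hx t ht))
  have h2 : ∑ j, (Real.exp (ctw n R δ T hT j) * v j) ^ 2 = w ⬝ᵥ w := by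
    rw [dotProduct_self_eq_sum_sq]
    exact Finset.sum_congr rfl fun j _ => by rw [hw j]
  rw [h2] at h1
  have hwwE : w ⬝ᵥ w ≤ w ⬝ᵥ (fineOpR n a m2 R).mulVec w / min 2 a := by
    rw [le_div_iff₀ hσ, mul_comm]; exact hpos_region hn hR ha.le hm w
  calc ∑ x ∈ S, v x ^ 2 ≤ Real.exp (-(2 * (δ * ρ))) * (w ⬝ᵥ w) := h1
    _ ≤ Real.exp (-(2 * (δ * ρ))) * (w ⬝ᵥ (fineOpR n a m2 R).mulVec w / min 2 a) :=
        mul_le_mul_of_nonneg_left hwwE (Real.exp_pos _).le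
    _ = Real.exp (-(2 * (δ * ρ))) / min 2 a * (w ⬝ᵥ (fineOpR n a m2 R).mulVec w) := by ring

/-- **GRADIENTS ON `S` FROM THE ENERGY**: `Σ_{x∈S} (D_μ v)(x)² ≤ 2e^{−2δρ}(1 + 4δ²/min(2,a))⟨w,Hw⟩` when
`dist_η(S,T) ≥ ρ` (weighted Leibniz + the Dirichlet-form bound `Σ(D_μ w)² ≤ ⟨w,Hw⟩`). [folklore] -/
theorem sum_fdiff_sq_le_energy (hn : 1 ≤ n) (hR : IsBlockUnion n R) {a m2 δ : ℝ} (ha : 0 < a) (hm : 0 ≤ m2)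
    (hδ0 : 0 ≤ δ) (hδ1 : δ ≤ 1) (T : Finset ↥R) (hT : T.Nonempty) (S : Finset ↥R) (ρ : ℝ)
    (hρ : ∀ x ∈ S, ∀ t ∈ T, ρ ≤ edistR n R x t) (v w : ↥R → ℝ)
    (hw : ∀ j, w j = Real.exp (ctw n R δ T hT j) * v j) (μ : Fin (d + 1)) :
    ∑ x ∈ S, fdiff n R μ v x ^ 2
      ≤ 2 * Real.exp (-(2 * (δ * ρ))) * (1 + 4 * δ ^ 2 / min 2 a) * (w ⬝ᵥ (fineOpR n a m2 R).mulVec w) := by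
  classical
  have hσ : 0 < min 2 a := lt_min (by norm_num) ha
  set φ := ctw n R δ T hT with hφ
  set H := fineOpR n a m2 R with hH
  have hLip : ∀ (x : ↥R) (h : x.1 + uvec μ ∈ R), |φ ⟨x.1 + uvec μ, h⟩ - φ x| ≤ δ / (n : ℝ) :=
    fun x h => abs_ctw_step_le hδ0 T hT x μ h
  have hx : ∀ x ∈ S, fdiff n R μ v x ^ 2
      ≤ Real.exp (-(2 * (δ * ρ))) * (2 * (fdiff n R μ w x ^ 2 + 4 * δ ^ 2 * extR w (x.1 + uvec μ) ^ 2)) := by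
    intro x hxS
    have h1 := exp_mul_abs_fdiff_le hn hδ1 φ v w hw μ hLip x
    have hlo : δ * ρ ≤ φ x := le_ctw hδ0 T hT (fun t ht => hρ x hxS t ht)
    have h2 : Real.exp (δ * ρ) * |fdiff n R μ v x| ≤ |fdiff n R μ w x| + 2 * δ * |extR w (x.1 + uvec μ)| :=
      (mul_le_mul_of_nonneg_right (Real.exp_le_exp.2 hlo) (abs_nonneg _)).trans h1
    have h3 : (Real.exp (δ * ρ) * |fdiff n R μ v x|) ^ 2
        ≤ (|fdiff n R μ w x| + 2 * δ * |extR w (x.1 + uvec μ)|) ^ 2 :=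
      pow_le_pow_left₀ (by positivity) h2 2
    have h4 : (|fdiff n R μ w x| + 2 * δ * |extR w (x.1 + uvec μ)|) ^ 2
        ≤ 2 * (fdiff n R μ w x ^ 2 + 4 * δ ^ 2 * extR w (x.1 + uvec μ) ^ 2) := by
      have : (|fdiff n R μ w x| + 2 * δ * |extR w (x.1 + uvec μ)|) ^ 2
          ≤ 2 * (|fdiff n R μ w x| ^ 2 + (2 * δ * |extR w (x.1 + uvec μ)|) ^ 2) := by
        nlinarith [sq_nonneg (|fdiff n R μ w x| - 2 * δ * |extR w (x.1 + uvec μ)|)]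
      calc _ ≤ _ := this
        _ = 2 * (fdiff n R μ w x ^ 2 + 4 * δ ^ 2 * extR w (x.1 + uvec μ) ^ 2) := by
            rw [sq_abs, mul_pow, mul_pow, sq_abs]; ring
    have hexp : Real.exp (-(2 * (δ * ρ))) * Real.exp (δ * ρ) ^ 2 = 1 := by
      rw [sq, ← Real.exp_add, ← Real.exp_add, ← Real.exp_zero]
      congr 1; ring
    calc fdiff n R μ v x ^ 2
        = Real.exp (-(2 * (δ * ρ))) * (Real.exp (δ * ρ) * |fdiff n R μ v x|) ^ 2 := by
          rw [mul_pow, sq_abs, ← mul_assoc, hexp, one_mul]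
      _ ≤ Real.exp (-(2 * (δ * ρ))) * (2 * (fdiff n R μ w x ^ 2 + 4 * δ ^ 2 * extR w (x.1 + uvec μ) ^ 2)) :=
          mul_le_mul_of_nonneg_left (h3.trans h4) (Real.exp_pos _).le
  have hDw : ∑ x, fdiff n R μ w x ^ 2 ≤ w ⬝ᵥ H.mulVec w := sum_fdiff_sq_le_form hn hR ha.le hm μ w
  have hshift : ∑ x ∈ S, extR w (x.1 + uvec μ) ^ 2 ≤ w ⬝ᵥ w := by
    rw [dotProduct_self_eq_sum_sq]; exact sum_sq_shift_le μ w S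
  have hwwE : w ⬝ᵥ w ≤ w ⬝ᵥ H.mulVec w / min 2 a := by
    rw [le_div_iff₀ hσ, mul_comm]; exact hpos_region hn hR ha.le hm w
  have hDS : ∑ x ∈ S, fdiff n R μ w x ^ 2 ≤ ∑ x, fdiff n R μ w x ^ 2 :=
    Finset.sum_le_sum_of_subset_of_nonneg (Finset.subset_univ S) fun x _ _ => sq_nonneg _
  calc ∑ x ∈ S, fdiff n R μ v x ^ 2
      ≤ ∑ x ∈ S, Real.exp (-(2 * (δ * ρ))) * (2 * (fdiff n R μ w x ^ 2 + 4 * δ ^ 2 * extR w (x.1 + uvec μ) ^ 2)) :=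
        Finset.sum_le_sum hx
    _ = ∑ x ∈ S, (2 * Real.exp (-(2 * (δ * ρ))) * fdiff n R μ w x ^ 2
          + 8 * δ ^ 2 * Real.exp (-(2 * (δ * ρ))) * extR w (x.1 + uvec μ) ^ 2) :=
        Finset.sum_congr rfl fun x _ => by ring
    _ = 2 * Real.exp (-(2 * (δ * ρ))) * ∑ x ∈ S, fdiff n R μ w x ^ 2
          + 8 * δ ^ 2 * Real.exp (-(2 * (δ * ρ))) * ∑ x ∈ S, extR w (x.1 + uvec μ) ^ 2 := by
        rw [Finset.sum_add_distrib, Finset.mul_sum, Finset.mul_sum]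
    _ ≤ 2 * Real.exp (-(2 * (δ * ρ))) * (w ⬝ᵥ H.mulVec w)
          + 8 * δ ^ 2 * Real.exp (-(2 * (δ * ρ))) * (w ⬝ᵥ H.mulVec w / min 2 a) :=
        add_le_add (mul_le_mul_of_nonneg_left (hDS.trans hDw) (by positivity))
          (mul_le_mul_of_nonneg_left (hshift.trans hwwE) (by positivity))
    _ = 2 * Real.exp (-(2 * (δ * ρ))) * (1 + 4 * δ ^ 2 / min 2 a) * (w ⬝ᵥ H.mulVec w) := by ring

end Decay

section SetToSet

variable {n : ℕ} {R : Finset (Fin (d + 1) → ℤ)}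

/-- a function supported in the empty set vanishes. [folklore] -/
theorem eq_zero_of_forall_not_mem {T : Finset ↥R} (hT : ¬T.Nonempty) (g : ↥R → ℝ) (hg : ∀ j, j ∉ T → g j = 0) :
    g = 0 := by
  ext j
  exact hg j (fun hj => hT ⟨j, hj⟩)

/-- **SET-TO-SET DECAY OF `G = G_k(Ω,0)` WITH MASS** (`L²` operator form, every mesh, every union of blocks):
`Σ_{x∈S} (Gg)(x)² ≤ (2/min(2,a))² e^{−2δρ} Σ g²` for `supp g ⊆ T`, `dist_η(S,T) ≥ ρ` — the massless case is
`B4Lower18.green_setDecay_region`. [cite: CombesThomas1973, §II] [folklore] -/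
theorem green_setDecay (hn : 1 ≤ n) (hR : IsBlockUnion n R) {a m2 δ : ℝ} (ha : 0 < a) (hm : 0 ≤ m2)
    (hδ0 : 0 ≤ δ) (hδ1 : δ ≤ 1) (hsmall : 2 * ((d : ℝ) + 1) * δ ^ 2 + a * (Real.exp δ - 1) ≤ min 2 a / 2)
    (S T : Finset ↥R) (ρ : ℝ) (hρ : ∀ x ∈ S, ∀ t ∈ T, ρ ≤ edistR n R x t) (g : ↥R → ℝ)
    (hg : ∀ j, j ∉ T → g j = 0) :
    ∑ x ∈ S, ((fineOpR n a m2 R)⁻¹.mulVec g) x ^ 2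
      ≤ (2 / min 2 a) ^ 2 * Real.exp (-(2 * (δ * ρ))) * ∑ j, g j ^ 2 := by
  have hσ : 0 < min 2 a := lt_min (by norm_num) ha
  by_cases hT : T.Nonempty
  · set v := (fineOpR n a m2 R)⁻¹.mulVec g with hv
    set w : ↥R → ℝ := fun j => Real.exp (ctw n R δ T hT j) * v j with hw
    have hE := energyA hn hR ha hm hδ0 hδ1 hsmall T hT g hg w (fun j => rfl)
    have hS := sum_sq_le_energy hn hR ha hm hδ0 T hT S ρ hρ v w (fun j => rfl) (m2 := m2)
    calc ∑ x ∈ S, v x ^ 2 ≤ Real.exp (-(2 * (δ * ρ))) / min 2 a * (w ⬝ᵥ (fineOpR n a m2 R).mulVec w) := hS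
      _ ≤ Real.exp (-(2 * (δ * ρ))) / min 2 a * (4 / min 2 a * ∑ j, g j ^ 2) :=
          mul_le_mul_of_nonneg_left hE (by positivity)
      _ = (2 / min 2 a) ^ 2 * Real.exp (-(2 * (δ * ρ))) * ∑ j, g j ^ 2 := by ring
  · have hg0 := eq_zero_of_forall_not_mem hT g hg
    rw [hg0, Matrix.mulVec_zero]
    simp only [Pi.zero_apply]
    norm_num

/-- **SET-TO-SET DECAY OF `D_μ G`**: `Σ_{x∈S} (D_μ G g)(x)² ≤ (8/min(2,a))(1 + 4δ²/min(2,a)) e^{−2δρ} Σ g²`.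
[cite: CombesThomas1973, §II] [folklore] -/
theorem dgreen_setDecay (hn : 1 ≤ n) (hR : IsBlockUnion n R) {a m2 δ : ℝ} (ha : 0 < a) (hm : 0 ≤ m2)
    (hδ0 : 0 ≤ δ) (hδ1 : δ ≤ 1) (hsmall : 2 * ((d : ℝ) + 1) * δ ^ 2 + a * (Real.exp δ - 1) ≤ min 2 a / 2)
    (S T : Finset ↥R) (ρ : ℝ) (hρ : ∀ x ∈ S, ∀ t ∈ T, ρ ≤ edistR n R x t) (g : ↥R → ℝ)
    (hg : ∀ j, j ∉ T → g j = 0) (μ : Fin (d + 1)) :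
    ∑ x ∈ S, fdiff n R μ ((fineOpR n a m2 R)⁻¹.mulVec g) x ^ 2
      ≤ 8 / min 2 a * (1 + 4 * δ ^ 2 / min 2 a) * Real.exp (-(2 * (δ * ρ))) * ∑ j, g j ^ 2 := by
  have hσ : 0 < min 2 a := lt_min (by norm_num) ha
  by_cases hT : T.Nonempty
  · set v := (fineOpR n a m2 R)⁻¹.mulVec g with hv
    set w : ↥R → ℝ := fun j => Real.exp (ctw n R δ T hT j) * v j with hw
    have hE := energyA hn hR ha hm hδ0 hδ1 hsmall T hT g hg w (fun j => rfl)
    have hS := sum_fdiff_sq_le_energy hn hR ha hm hδ0 hδ1 T hT S ρ hρ v w (fun j => rfl) μ (m2 := m2)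
    calc ∑ x ∈ S, fdiff n R μ v x ^ 2
        ≤ 2 * Real.exp (-(2 * (δ * ρ))) * (1 + 4 * δ ^ 2 / min 2 a) * (w ⬝ᵥ (fineOpR n a m2 R).mulVec w) := hS
      _ ≤ 2 * Real.exp (-(2 * (δ * ρ))) * (1 + 4 * δ ^ 2 / min 2 a) * (4 / min 2 a * ∑ j, g j ^ 2) :=
          mul_le_mul_of_nonneg_left hE (by positivity)
      _ = 8 / min 2 a * (1 + 4 * δ ^ 2 / min 2 a) * Real.exp (-(2 * (δ * ρ))) * ∑ j, g j ^ 2 := by ring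
  · have hg0 := eq_zero_of_forall_not_mem hT g hg
    rw [hg0, Matrix.mulVec_zero, fdiff_zero]
    simp

/-- **SET-TO-SET DECAY OF `G D_ν^⊤`**: `Σ_{x∈S} (G D_ν^⊤ f')(x)² ≤ (8/min(2,a))(1 + 4δ²/min(2,a)) e^{−2δρ} Σ f'²` for
`supp f' ⊆ T` — uniform in the mesh although `‖D^⊤f'‖₂ ∼ n‖f'‖₂`. [cite: CombesThomas1973, §II] [folklore] -/
theorem greenT_setDecay (hn : 1 ≤ n) (hR : IsBlockUnion n R) {a m2 δ : ℝ} (ha : 0 < a) (hm : 0 ≤ m2)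
    (hδ0 : 0 ≤ δ) (hδ1 : δ ≤ 1) (hsmall : 2 * ((d : ℝ) + 1) * δ ^ 2 + a * (Real.exp δ - 1) ≤ min 2 a / 2)
    (S T : Finset ↥R) (ρ : ℝ) (hρ : ∀ x ∈ S, ∀ t ∈ T, ρ ≤ edistR n R x t) (ν : Fin (d + 1)) (f' : ↥R → ℝ)
    (hf' : ∀ j, j ∉ T → f' j = 0) :
    ∑ x ∈ S, ((fineOpR n a m2 R)⁻¹.mulVec (fdiffT n R ν f')) x ^ 2
      ≤ 8 / min 2 a * (1 + 4 * δ ^ 2 / min 2 a) * Real.exp (-(2 * (δ * ρ))) * ∑ j, f' j ^ 2 := by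
  have hσ : 0 < min 2 a := lt_min (by norm_num) ha
  by_cases hT : T.Nonempty
  · set v := (fineOpR n a m2 R)⁻¹.mulVec (fdiffT n R ν f') with hv
    set w : ↥R → ℝ := fun j => Real.exp (ctw n R δ T hT j) * v j with hw
    have hE := energyB hn hR ha hm hδ0 hδ1 hsmall T hT ν f' hf' w (fun j => rfl)
    have hS := sum_sq_le_energy hn hR ha hm hδ0 T hT S ρ hρ v w (fun j => rfl) (m2 := m2)
    calc ∑ x ∈ S, v x ^ 2 ≤ Real.exp (-(2 * (δ * ρ))) / min 2 a * (w ⬝ᵥ (fineOpR n a m2 R).mulVec w) := hS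
      _ ≤ Real.exp (-(2 * (δ * ρ))) / min 2 a * (8 * (1 + 4 * δ ^ 2 / min 2 a) * ∑ j, f' j ^ 2) :=
          mul_le_mul_of_nonneg_left hE (by positivity)
      _ = 8 / min 2 a * (1 + 4 * δ ^ 2 / min 2 a) * Real.exp (-(2 * (δ * ρ))) * ∑ j, f' j ^ 2 := by ring
  · have h0 := eq_zero_of_forall_not_mem hT f' hf'
    rw [h0, fdiffT_zero, Matrix.mulVec_zero]
    simp only [Pi.zero_apply]
    norm_num

/-- **SET-TO-SET DECAY OF `D_μ G D_ν^⊤`**: `Σ_{x∈S} (D_μ G D_ν^⊤ f')(x)² ≤ 16(1 + 4δ²/min(2,a))² e^{−2δρ} Σ f'²`.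
[cite: CombesThomas1973, §II] [folklore] -/
theorem dgreenT_setDecay (hn : 1 ≤ n) (hR : IsBlockUnion n R) {a m2 δ : ℝ} (ha : 0 < a) (hm : 0 ≤ m2)
    (hδ0 : 0 ≤ δ) (hδ1 : δ ≤ 1) (hsmall : 2 * ((d : ℝ) + 1) * δ ^ 2 + a * (Real.exp δ - 1) ≤ min 2 a / 2)
    (S T : Finset ↥R) (ρ : ℝ) (hρ : ∀ x ∈ S, ∀ t ∈ T, ρ ≤ edistR n R x t) (μ ν : Fin (d + 1))
    (f' : ↥R → ℝ) (hf' : ∀ j, j ∉ T → f' j = 0) :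
    ∑ x ∈ S, fdiff n R μ ((fineOpR n a m2 R)⁻¹.mulVec (fdiffT n R ν f')) x ^ 2
      ≤ 16 * (1 + 4 * δ ^ 2 / min 2 a) ^ 2 * Real.exp (-(2 * (δ * ρ))) * ∑ j, f' j ^ 2 := by
  have hσ : 0 < min 2 a := lt_min (by norm_num) ha
  by_cases hT : T.Nonempty
  · set v := (fineOpR n a m2 R)⁻¹.mulVec (fdiffT n R ν f') with hv
    set w : ↥R → ℝ := fun j => Real.exp (ctw n R δ T hT j) * v j with hw
    have hE := energyB hn hR ha hm hδ0 hδ1 hsmall T hT ν f' hf' w (fun j => rfl)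
    have hS := sum_fdiff_sq_le_energy hn hR ha hm hδ0 hδ1 T hT S ρ hρ v w (fun j => rfl) μ (m2 := m2)
    calc ∑ x ∈ S, fdiff n R μ v x ^ 2
        ≤ 2 * Real.exp (-(2 * (δ * ρ))) * (1 + 4 * δ ^ 2 / min 2 a) * (w ⬝ᵥ (fineOpR n a m2 R).mulVec w) := hS
      _ ≤ 2 * Real.exp (-(2 * (δ * ρ))) * (1 + 4 * δ ^ 2 / min 2 a)
            * (8 * (1 + 4 * δ ^ 2 / min 2 a) * ∑ j, f' j ^ 2) :=
          mul_le_mul_of_nonneg_left hE (by positivity)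
      _ = 16 * (1 + 4 * δ ^ 2 / min 2 a) ^ 2 * Real.exp (-(2 * (δ * ρ))) * ∑ j, f' j ^ 2 := by ring
  · have h0 := eq_zero_of_forall_not_mem hT f' hf'
    rw [h0, fdiffT_zero, Matrix.mulVec_zero, fdiff_zero]
    simp

end SetToSet

/-! ## §E  Corollary 2.3 (2.30) at `A = 0`: the four pairings, one constant `c₀(a)`, one rate `δ₀(d,a)` -/

/-- the `ℓ²` norm of a function on the fine points of the region (counting normalisation; Bałaban's
`η^{d+1}`-weighted `‖·‖₂` is `η^{(d+1)/2}` times it, on both sides of (2.30)). [folklore] -/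
def l2n {R : Finset (Fin (d + 1) → ℤ)} (f : ↥R → ℝ) : ℝ := Real.sqrt (∑ x, f x ^ 2)

/-- **THE CONSTANT `c₀` OF (2.30) AT `A = 0`, EXPLICIT**: `c₀(a) = 4(1 + 4/min(2,a))(1 + 1/min(2,a))` — depends on `a`
only (not on `d`, the mesh, the mass or the region). [cite: Balaban1983RegularityDecay, p. 580 (2.30), case A = 0] -/
def c0 (a : ℝ) : ℝ := 4 * (1 + 4 / min 2 a) * (1 + 1 / min 2 a)

/-- **THE RATE `δ₀` OF (2.30) AT `A = 0`, EXPLICIT**: `δ₀(d,a) = min(2,a)/(4(d+1+a))`.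
[cite: Balaban1983RegularityDecay, p. 580 (2.30), case A = 0] -/
def delta0 (d : ℕ) (a : ℝ) : ℝ := min 2 a / (4 * ((d : ℝ) + 1 + a))

section Pairings

variable {n : ℕ} {R : Finset (Fin (d + 1) → ℤ)}

/-- `c₀(a) > 0`. [folklore] -/
theorem c0_pos {a : ℝ} (ha : 0 < a) : 0 < c0 a := by
  have hσ : 0 < min 2 a := lt_min (by norm_num) ha
  unfold c0; positivity

/-- the three constants of §D are dominated by `c₀(a)²` for `0 ≤ δ ≤ 1`. [folklore] -/
theorem consts_le_c0_sq {a δ : ℝ} (ha : 0 < a) (hδ0 : 0 ≤ δ) (hδ1 : δ ≤ 1) :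
    (2 / min 2 a) ^ 2 ≤ c0 a ^ 2 ∧ 8 / min 2 a * (1 + 4 * δ ^ 2 / min 2 a) ≤ c0 a ^ 2
      ∧ 16 * (1 + 4 * δ ^ 2 / min 2 a) ^ 2 ≤ c0 a ^ 2 := by
  have hσ : 0 < min 2 a := lt_min (by norm_num) ha
  set s : ℝ := 1 / min 2 a with hs
  have hs0 : 0 < s := by positivity
  have hδ2 : δ ^ 2 ≤ 1 := by nlinarith
  have e1 : 2 / min 2 a = 2 * s := by rw [hs]; ring
  have e2 : 8 / min 2 a = 8 * s := by rw [hs]; ring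
  have e3 : 4 * δ ^ 2 / min 2 a = 4 * δ ^ 2 * s := by rw [hs]; ring
  have e4 : c0 a = 4 * (1 + 4 * s) * (1 + s) := by unfold c0; rw [hs]; ring
  have hA : 1 + 4 * δ ^ 2 * s ≤ 1 + 4 * s := by nlinarith
  have hA0 : 0 ≤ 1 + 4 * δ ^ 2 * s := by positivity
  rw [e1, e2, e3, e4]
  refine ⟨by nlinarith, ?_, ?_⟩
  · calc 8 * s * (1 + 4 * δ ^ 2 * s) ≤ 8 * s * (1 + 4 * s) := mul_le_mul_of_nonneg_left hA (by positivity)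
      _ ≤ 16 * (1 + 4 * s) ^ 2 * (1 + s) ^ 2 := by
          have h1 : 8 * s ≤ 16 * (1 + 4 * s) * (1 + s) ^ 2 := by nlinarith [sq_nonneg s]
          have h2 : 0 ≤ 1 + 4 * s := by positivity
          calc 8 * s * (1 + 4 * s) = (8 * s) * (1 + 4 * s) := by ring
            _ ≤ (16 * (1 + 4 * s) * (1 + s) ^ 2) * (1 + 4 * s) := mul_le_mul_of_nonneg_right h1 h2
            _ = 16 * (1 + 4 * s) ^ 2 * (1 + s) ^ 2 := by ring
      _ = (4 * (1 + 4 * s) * (1 + s)) ^ 2 := by ring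
  · calc 16 * (1 + 4 * δ ^ 2 * s) ^ 2 ≤ 16 * (1 + 4 * s) ^ 2 := by
          refine mul_le_mul_of_nonneg_left (pow_le_pow_left₀ hA0 hA 2) (by norm_num)
      _ = 16 * (1 + 4 * s) ^ 2 * 1 := by ring
      _ ≤ 16 * (1 + 4 * s) ^ 2 * (1 + s) ^ 2 :=
          mul_le_mul_of_nonneg_left (by nlinarith) (by positivity)
      _ = (4 * (1 + 4 * s) * (1 + s)) ^ 2 := by ring

/-- **FROM A SET-TO-SET SQUARE BOUND TO A PAIRING BOUND** (Cauchy–Schwarz): if `supp f ⊆ S` and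
`Σ_{x∈S} X(x)² ≤ C²·B` then `|⟨f, X⟩| ≤ C‖f‖₂√B`. [folklore] -/
theorem abs_dot_le_of_setSq (f X : ↥R → ℝ) (S : Finset ↥R) (hf : ∀ x, x ∉ S → f x = 0) {C B : ℝ}
    (hC : 0 ≤ C) (hX : ∑ x ∈ S, X x ^ 2 ≤ C ^ 2 * B) :
    |f ⬝ᵥ X| ≤ C * l2n f * Real.sqrt B := by
  classical
  have h1 : f ⬝ᵥ X = ∑ x ∈ S, f x * X x := by
    simp only [dotProduct]
    rw [← Finset.sum_subset (Finset.subset_univ S)]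
    intro x _ hx
    rw [hf x hx, zero_mul]
  have h2 : (f ⬝ᵥ X) ^ 2 ≤ (∑ x, f x ^ 2) * (C ^ 2 * B) := by
    rw [h1]
    calc (∑ x ∈ S, f x * X x) ^ 2 ≤ (∑ x ∈ S, f x ^ 2) * ∑ x ∈ S, X x ^ 2 := sq_sum_mul_le S f X
      _ ≤ (∑ x, f x ^ 2) * (C ^ 2 * B) :=
          mul_le_mul (Finset.sum_le_sum_of_subset_of_nonneg (Finset.subset_univ S) fun x _ _ => sq_nonneg _) hX
            (Finset.sum_nonneg fun x _ => sq_nonneg _) (Finset.sum_nonneg fun x _ => sq_nonneg _)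
  have h3 : |f ⬝ᵥ X| = Real.sqrt ((f ⬝ᵥ X) ^ 2) := (Real.sqrt_sq_eq_abs _).symm
  rw [h3]
  calc Real.sqrt ((f ⬝ᵥ X) ^ 2) ≤ Real.sqrt ((∑ x, f x ^ 2) * (C ^ 2 * B)) := Real.sqrt_le_sqrt h2
    _ = Real.sqrt (∑ x, f x ^ 2) * (Real.sqrt (C ^ 2) * Real.sqrt B) := by
        rw [Real.sqrt_mul (Finset.sum_nonneg fun x _ => sq_nonneg _), Real.sqrt_mul (sq_nonneg C)]
    _ = C * l2n f * Real.sqrt B := by rw [Real.sqrt_sq hC, l2n]; ring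

/-- **B4 COROLLARY 2.3 (2.30) AT `A = 0` — THE FOUR PAIRINGS, `η`-UNIFORM, WITH MASS, ON EVERY FINITE UNION OF
BLOCKS, in set form**: for `a > 0`, `m² ≥ 0`, every mesh `η = 1/n`, every union `R = η⁻¹Ω` of `n`-blocks,
`0 ≤ δ ≤ 1` with `2(d+1)δ² + a(e^δ − 1) ≤ min(2,a)/2`, `supp f ⊆ S`, `supp f' ⊆ T`, `dist_η(S,T) ≥ ρ`, and
`G = (n²(−Δ^N_R) + m² + (a/n^{d+1})1_{same block})⁻¹` (= `G_k(Ω,0)` in the counting basis):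
`|⟨f, Gf'⟩|, |⟨f, D_μGf'⟩|, |⟨f, GD_ν^⊤f'⟩|, |⟨f, D_μGD_ν^⊤f'⟩| ≤ c₀(a) e^{−δρ} ‖f‖₂‖f'‖₂` — the printed
«|⟨f, G_k(Ω,A)f'⟩|, |⟨f, D^η_{A,μ}G_k(Ω,A)f'⟩|, |⟨f, G_k(Ω,A)D^{η*}_{A,ν}f'⟩|, |⟨f, D^η_{A,μ}G_k(Ω,A)D^{η*}_{A,ν}f'⟩| ≤
c₀e^{−δ₀dist(supp f, supp f')}‖f‖₂‖f'‖₂» at `A = 0` (sup-distance in `η`-units; the two sides scale by the same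
`η^{d+1}` between the counting and the `η^{d+1}`-weighted inner products).
[cite: Balaban1983RegularityDecay, p. 580 Corollary 2.3 (2.30), case A = 0] -/
theorem cor23_pairings_set (hn : 1 ≤ n) (hR : IsBlockUnion n R) {a m2 δ : ℝ} (ha : 0 < a) (hm : 0 ≤ m2)
    (hδ0 : 0 ≤ δ) (hδ1 : δ ≤ 1) (hsmall : 2 * ((d : ℝ) + 1) * δ ^ 2 + a * (Real.exp δ - 1) ≤ min 2 a / 2)
    (S T : Finset ↥R) (ρ : ℝ) (hρ : ∀ x ∈ S, ∀ t ∈ T, ρ ≤ edistR n R x t) (f f' : ↥R → ℝ)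
    (hf : ∀ x, x ∉ S → f x = 0) (hf' : ∀ x, x ∉ T → f' x = 0) (μ ν : Fin (d + 1)) :
    |f ⬝ᵥ (fineOpR n a m2 R)⁻¹.mulVec f'| ≤ c0 a * Real.exp (-(δ * ρ)) * l2n f * l2n f'
    ∧ |f ⬝ᵥ fdiff n R μ ((fineOpR n a m2 R)⁻¹.mulVec f')| ≤ c0 a * Real.exp (-(δ * ρ)) * l2n f * l2n f'
    ∧ |f ⬝ᵥ (fineOpR n a m2 R)⁻¹.mulVec (fdiffT n R ν f')| ≤ c0 a * Real.exp (-(δ * ρ)) * l2n f * l2n f'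
    ∧ |f ⬝ᵥ fdiff n R μ ((fineOpR n a m2 R)⁻¹.mulVec (fdiffT n R ν f'))|
        ≤ c0 a * Real.exp (-(δ * ρ)) * l2n f * l2n f' := by
  have hσ : 0 < min 2 a := lt_min (by norm_num) ha
  obtain ⟨k1, k2, k3⟩ := consts_le_c0_sq ha hδ0 hδ1
  have hc : 0 ≤ c0 a * Real.exp (-(δ * ρ)) := (mul_pos (c0_pos ha) (Real.exp_pos _)).le
  have hB : 0 ≤ ∑ j, f' j ^ 2 := Finset.sum_nonneg fun j _ => sq_nonneg _
  have hexp : Real.exp (-(2 * (δ * ρ))) = Real.exp (-(δ * ρ)) ^ 2 := by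
    rw [← Real.exp_nat_mul]; push_cast; ring_nf
  have hCsq : (c0 a * Real.exp (-(δ * ρ))) ^ 2 = c0 a ^ 2 * Real.exp (-(2 * (δ * ρ))) := by rw [hexp]; ring
  have he0 : 0 ≤ Real.exp (-(2 * (δ * ρ))) := (Real.exp_pos _).le
  have conv : ∀ {K : ℝ} {X : ↥R → ℝ}, K ≤ c0 a ^ 2 →
      ∑ x ∈ S, X x ^ 2 ≤ K * Real.exp (-(2 * (δ * ρ))) * ∑ j, f' j ^ 2 →
      |f ⬝ᵥ X| ≤ c0 a * Real.exp (-(δ * ρ)) * l2n f * l2n f' := by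
    intro K X hK hX
    have hX' : ∑ x ∈ S, X x ^ 2 ≤ (c0 a * Real.exp (-(δ * ρ))) ^ 2 * ∑ j, f' j ^ 2 := by
      rw [hCsq]
      exact hX.trans (mul_le_mul_of_nonneg_right (mul_le_mul_of_nonneg_right hK he0) hB)
    exact abs_dot_le_of_setSq f X S hf hc hX'
  exact ⟨conv k1 (green_setDecay hn hR ha hm hδ0 hδ1 hsmall S T ρ hρ f' hf'),
    conv k2 (dgreen_setDecay hn hR ha hm hδ0 hδ1 hsmall S T ρ hρ f' hf' μ),
    conv k2 (greenT_setDecay hn hR ha hm hδ0 hδ1 hsmall S T ρ hρ ν f' hf'),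
    conv k3 (dgreenT_setDecay hn hR ha hm hδ0 hδ1 hsmall S T ρ hρ μ ν f' hf')⟩

/-- **THE EXPLICIT RATE IS ADMISSIBLE**: `δ₀ = min(2,a)/(4(d+1+a))` satisfies `0 ≤ δ₀ ≤ 1` and the `η`-free smallness
`2(d+1)δ₀² + a(e^{δ₀} − 1) ≤ min(2,a)/2` (via `e^δ − 1 ≤ δ + δ²` for `δ ≤ 1`). [folklore] -/
theorem delta0_admissible (d : ℕ) {a : ℝ} (ha : 0 < a) :
    0 ≤ delta0 d a ∧ delta0 d a ≤ 1
      ∧ 2 * ((d : ℝ) + 1) * delta0 d a ^ 2 + a * (Real.exp (delta0 d a) - 1) ≤ min 2 a / 2 := by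
  have hσ : 0 < min 2 a := lt_min (by norm_num) ha
  have hσ2 : min 2 a ≤ 2 := min_le_left _ _
  have hD : 0 < (d : ℝ) + 1 + a := by positivity
  set δ := delta0 d a with hδ
  have hδ0 : 0 ≤ δ := by rw [hδ]; unfold delta0; positivity
  have hkey : 4 * ((d : ℝ) + 1 + a) * δ = min 2 a := by
    rw [hδ]; unfold delta0; field_simp
  have hδ1 : δ ≤ 1 := by
    have hd0 : (0 : ℝ) ≤ d := Nat.cast_nonneg d
    nlinarith
  refine ⟨hδ0, hδ1, ?_⟩
  have h1 : |Real.exp δ - 1 - δ| ≤ δ ^ 2 := Real.abs_exp_sub_one_sub_id_le (by rw [abs_of_nonneg hδ0]; exact hδ1)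
  have h2 : Real.exp δ - 1 ≤ δ + δ ^ 2 := by linarith [(abs_le.1 h1).2]
  have h3 : δ ^ 2 ≤ δ := by nlinarith
  have hd0 : (0 : ℝ) ≤ d := Nat.cast_nonneg d
  calc 2 * ((d : ℝ) + 1) * δ ^ 2 + a * (Real.exp δ - 1)
      ≤ 2 * ((d : ℝ) + 1) * δ + a * (δ + δ) := by
        have := mul_le_mul_of_nonneg_left h2 ha.le
        nlinarith
    _ = (4 * ((d : ℝ) + 1 + a) * δ) / 2 := by ring
    _ = min 2 a / 2 := by rw [hkey]

end Pairings

/-! ## §F  The printed form: `dist(supp f, supp f')`, the explicit `c₀`, `δ₀`, every `f, f'` -/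

section Printed

variable {n : ℕ} {R : Finset (Fin (d + 1) → ℤ)}

/-- the support of a function on the fine points. [folklore] -/
def supp (f : ↥R → ℝ) : Finset ↥R := Finset.univ.filter fun x => f x ≠ 0

/-- off its support a function vanishes. [folklore] -/
theorem eq_zero_of_not_mem_supp (f : ↥R → ℝ) (x : ↥R) (hx : x ∉ supp f) : f x = 0 := by
  by_contra h
  exact hx (Finset.mem_filter.2 ⟨Finset.mem_univ x, h⟩)

/-- `dist_η(supp f, supp f')` in the `η`-scaled sup-norm (and `0` if a support is empty). [folklore] -/
def suppDist (n : ℕ) (R : Finset (Fin (d + 1) → ℤ)) (f f' : ↥R → ℝ) : ℝ :=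
  if h : (supp f ×ˢ supp f').Nonempty then (supp f ×ˢ supp f').inf' h (fun p => edistR n R p.1 p.2) else 0

/-- `dist_η(supp f, supp f') ≤ dist_η(x,t)` for `x ∈ supp f`, `t ∈ supp f'`. [folklore] -/
theorem suppDist_le (f f' : ↥R → ℝ) {x t : ↥R} (hx : x ∈ supp f) (ht : t ∈ supp f') :
    suppDist n R f f' ≤ edistR n R x t := by
  have hmem : (x, t) ∈ supp f ×ˢ supp f' := Finset.mk_mem_product hx ht
  have hne : (supp f ×ˢ supp f').Nonempty := ⟨(x, t), hmem⟩
  unfold suppDist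
  rw [dif_pos hne]
  exact Finset.inf'_le (fun p : ↥R × ↥R => edistR n R p.1 p.2) hmem

/-- `dist_η(supp f, supp f') ≥ 0`. [folklore] -/
theorem suppDist_nonneg (f f' : ↥R → ℝ) : 0 ≤ suppDist n R f f' := by
  unfold suppDist
  split_ifs with h
  · exact Finset.le_inf' h _ fun p _ => edistR_nonneg p.1 p.2
  · exact le_rfl

/-- **B4 COROLLARY 2.3 (2.30) AT `A = 0`, PRINTED QUANTIFIER SHAPE** — «there exist positive constants c₀, δ₀ such
that for arbitrary scalar field configurations f, f′ defined on Ω, we have (2.30)»: for every `a > 0` the EXPLICIT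
`c₀(a) = 4(1 + 4/min(2,a))(1 + 1/min(2,a))` and `δ₀(d,a) = min(2,a)/(4(d+1+a))` serve EVERY mesh `η = 1/n`, EVERY
finite union `Ω` of unit blocks (`R = fineDom n Ω`, or any union of `n`-blocks), EVERY mass `m² ≥ 0` and EVERY pair
`f, f'`:  `|⟨f, Gf'⟩|, |⟨f, D_μGf'⟩|, |⟨f, GD_ν^⊤f'⟩|, |⟨f, D_μGD_ν^⊤f'⟩| ≤ c₀ e^{−δ₀ dist_η(supp f, supp f')} ‖f‖₂‖f'‖₂`.
(Zero field only; the `δG_k(Ω,Ω₀,A)` clause of the Corollary is NOT in this module.)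
[cite: Balaban1983RegularityDecay, p. 580–581 Corollary 2.3 (2.30), case A = 0] -/
theorem cor23_main_zeroField (hn : 1 ≤ n) (hR : IsBlockUnion n R) {a m2 : ℝ} (ha : 0 < a) (hm : 0 ≤ m2)
    (f f' : ↥R → ℝ) (μ ν : Fin (d + 1)) :
    |f ⬝ᵥ (fineOpR n a m2 R)⁻¹.mulVec f'|
        ≤ c0 a * Real.exp (-(delta0 d a * suppDist n R f f')) * l2n f * l2n f'
    ∧ |f ⬝ᵥ fdiff n R μ ((fineOpR n a m2 R)⁻¹.mulVec f')|
        ≤ c0 a * Real.exp (-(delta0 d a * suppDist n R f f')) * l2n f * l2n f'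
    ∧ |f ⬝ᵥ (fineOpR n a m2 R)⁻¹.mulVec (fdiffT n R ν f')|
        ≤ c0 a * Real.exp (-(delta0 d a * suppDist n R f f')) * l2n f * l2n f'
    ∧ |f ⬝ᵥ fdiff n R μ ((fineOpR n a m2 R)⁻¹.mulVec (fdiffT n R ν f'))|
        ≤ c0 a * Real.exp (-(delta0 d a * suppDist n R f f')) * l2n f * l2n f' := by
  obtain ⟨h0, h1, hsmall⟩ := delta0_admissible d ha
  exact cor23_pairings_set hn hR ha hm h0 h1 hsmall (supp f) (supp f') (suppDist n R f f')
    (fun x hx t ht => suppDist_le f f' hx ht) f f' (eq_zero_of_not_mem_supp f) (eq_zero_of_not_mem_supp f') μ ν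

/-- **ON THE FINE REGION OVER ANY FINITE SET OF UNIT LABELS** (`R = fineDom n Ω`, the union of the blocks `B(y)`,
`y ∈ Ω`): the same statement, hypothesis-free in `Ω`. [cite: Balaban1983RegularityDecay, p. 580–581 Corollary 2.3
(2.30), case A = 0] -/
theorem cor23_main_zeroField_fineDom (hn : 1 ≤ n) (Ω : Finset (Fin (d + 1) → ℤ)) {a m2 : ℝ} (ha : 0 < a)
    (hm : 0 ≤ m2) (f f' : ↥(fineDom n Ω) → ℝ) (μ ν : Fin (d + 1)) :
    |f ⬝ᵥ (fineOpR n a m2 (fineDom n Ω))⁻¹.mulVec f'|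
        ≤ c0 a * Real.exp (-(delta0 d a * suppDist n (fineDom n Ω) f f')) * l2n f * l2n f'
    ∧ |f ⬝ᵥ fdiff n (fineDom n Ω) μ ((fineOpR n a m2 (fineDom n Ω))⁻¹.mulVec f')|
        ≤ c0 a * Real.exp (-(delta0 d a * suppDist n (fineDom n Ω) f f')) * l2n f * l2n f'
    ∧ |f ⬝ᵥ (fineOpR n a m2 (fineDom n Ω))⁻¹.mulVec (fdiffT n (fineDom n Ω) ν f')|
        ≤ c0 a * Real.exp (-(delta0 d a * suppDist n (fineDom n Ω) f f')) * l2n f * l2n f'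
    ∧ |f ⬝ᵥ fdiff n (fineDom n Ω) μ ((fineOpR n a m2 (fineDom n Ω))⁻¹.mulVec (fdiffT n (fineDom n Ω) ν f'))|
        ≤ c0 a * Real.exp (-(delta0 d a * suppDist n (fineDom n Ω) f f')) * l2n f * l2n f' :=
  cor23_main_zeroField hn (fineDom_isBlockUnion hn Ω) ha hm f f' μ ν

/-- Sanity instance (non-vacuity, explicit numbers): in dimension `d + 1 = 4`, at `a = 1` (`min(2,a) = 1`,
`c₀ = 4·5·2 = 40`, `δ₀ = 1/20`), mesh `η = 1/8`, mass `m² = 3`, for EVERY finite `Ω ⊂ ℤ⁴` of unit labels and every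
`f, f'` on the fine region: `|⟨f, D_0 G D_1^⊤ f'⟩| ≤ 40·e^{−dist_η(supp f,supp f')/20}‖f‖₂‖f'‖₂`. -/
example (Ω : Finset (Fin 4 → ℤ)) (f f' : ↥(fineDom 8 Ω) → ℝ) :
    |f ⬝ᵥ fdiff 8 (fineDom 8 Ω) 0 ((fineOpR (d := 3) 8 1 3 (fineDom 8 Ω))⁻¹.mulVec (fdiffT 8 (fineDom 8 Ω) 1 f'))|
      ≤ 40 * Real.exp (-((1 / 20) * suppDist 8 (fineDom 8 Ω) f f')) * l2n f * l2n f' := by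
  have h := (cor23_main_zeroField_fineDom (d := 3) (by norm_num) Ω one_pos (by norm_num : (0 : ℝ) ≤ 3) f f' 0 1).2.2.2
  have hc : c0 1 = 40 := by unfold c0; rw [min_eq_right (by norm_num : (1 : ℝ) ≤ 2)]; norm_num
  have hd : delta0 3 1 = 1 / 20 := by unfold delta0; rw [min_eq_right (by norm_num : (1 : ℝ) ≤ 2)]; norm_num
  rwa [hc, hd] at h

end Printed

end

end Literature.MathematicalPhysics.QuantumFieldTheory.Balaban1983to89.B4Cor23Zero
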